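import Literature.MathematicalPhysics.QuantumFieldTheory.Balaban1983to89.B9Eq3105FamThreeAtLocCfgOfTailsClosed
import Literature.MathematicalPhysics.QuantumFieldTheory.Balaban1983to89.B9Eq3105FamThreeLocCDiffCubeTailsGK
import Literature.MathematicalPhysics.QuantumFieldTheory.Balaban1983to89.B9Eq3105FamThreeCommStepsAtDatum
import Literature.MathematicalPhysics.QuantumFieldTheory.Balaban1983to89.B9GeoInputsMultiRateKLevelV1
import Literature.MathematicalPhysics.QuantumFieldTheory.Balaban1983to89.B9Cor36GCubeLocDefectAtLocCfg
import Literature.MathematicalPhysics.QuantumFieldTheory.Balaban1983to89.B9Cor36GpCoverBindersUnitary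

/-!
# `Balaban1983to89.B9Eq3105FamThreeAtMember` — FAMILY 3 OF [B9] (3.105) AS AN ∃-THRESHOLD PACKAGE AT THE MEMBER: the `hrest` record
# `B9Eq3105FamThreeAtLocCfgOfTailsClosed.hasMajorant_sum_famThree_at_locCfg_of_tails_closed` (p38 g48 over p33 FILE 7) with ALL its displayed cube-side
# letters (`hR □`, `hT □`, the units), located outer entries (`hLw`, `hRop` — p33 FILE 8a), cube tails (`hTail0∕1∕2`, `hSbL`, `hGw`, `hPb`, `hXc` — FILES 8b∕8c),
# member (2.61) inequalities, scale transfers and ~60 rate∕budget letters DISCHARGED from the three per-cube ∃-packages (p38 E3f `commSteps_at_datum`,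
# p21 `cinv_cube_at_locCfg`, p33 `gp_cube_entries_at_locCfg`) and the member geometry packages, above ONE set of thresholds; kernel
# `Θ₃·e^{−κ₃M_h}·e^{−ρ₃d}` with `ρ₃, κ₃, Θ₃` MEMBER-INDEPENDENT (the bond-sector member ASSEMBLER, file P3; seat p33 gen 105)

T. Bałaban, *Propagators for lattice gauge theories in a background field*, Commun. Math. Phys. **99** (1985) 389–434
[`Balaban1985BackgroundPropagators`, "B9"]; [4] = T. Bałaban, *Propagators and renormalization transformations for lattice gauge theories. II*,
Commun. Math. Phys. **96** (1984) 223–250 [`Balaban1984PropagatorsII`].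

statement-level skeleton of published theorems with citation tags; proofs where landed; nothing here is a claim about the
Yang–Mills mass gap

THE PRINTED LOCUS (held `paper:balaban1985-cmp99-background-propagators`, journal page = PDF page + 388).  p. 414 (3.105)–(3.106) (third sum
«Σ_□ζ_□̃(DPD* − DP_□D*)h_□G_□h_□», «R satisfies the bound (3.85) with O(M⁻¹) instead of O(α₁). For M sufficiently large this implies G = G₀(I − R)⁻¹»);
p. 415 l. 26–37 (the commutator∕localisation analysis of the families); p. 411 l. 36–41 («… e^{−(1∕4)δ₀M}»); Cor. 3.6 p. 408; Thm 3.10 p. 416;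
[4] Lemma 2.1 (2.60)–(2.61) p. 234.

WHY THIS FILE (cell `lit-balaban`; target = the displayed hypothesis of t2s-1's `B8Thm2TorusCoverOfDeltaAAssembler.hThm2Cover_of_prop6_deltaAAssembler`;
scope memo `run/shared/lean/pub/lit-balaban/lit-balaban-p33/g105/ASSEMBLER-SCOPE.md`).  After p33 g104 ∕ p38 g48 the family-3 `hrest` record displays no
analytic input any more — only ROUTE-NOTE inputs: the cube-side letters and data (∃-supplied per cube by E3f ∕ p21 ∕ p33 packages), the located tails of FILE 6
(supplied by FILES 8a∕8b∕8c from those data), the member's (2.61)s and scale transfers (p21∕p33 geometry packages) and some sixty rate letters tied by linear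
budgets.  THIS FILE performs exactly that bookkeeping ONCE: every rate is an explicit multiple of `m = min(δ_G, δ_X, δ_O, δ_S, δ_C, δ_B)` (the block rates of
`G′`, `(Q′G′²Q′*)⁻¹`, `O_□` and the three cube packages' rates), every threshold is a `max`, every (3.37) size an `a₁ = min`, and the collar factors
`e^{−a(3M_h∕8 − k)}` (`k ≤ 3`, `M_h ≥ 8`) are bounded by ONE factor `e^{(9∕128)m}·e^{−(9m∕1024)M_h}`.  RESULT: family 3 in the shape of the family-4 ∕ defect
packages — `∃ ρ₃ κ₃ > 0, Θ₃ ≥ 0, M₀ T₀ N₀ a₁`, for every member above the thresholds with `c_f = L^k` and every family of per-cube (3.35) data (twelve clauses),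
the family-3 sum `≺ Θ₃·e^{−κ₃M_h}·e^{−ρ₃d}` modulo ONLY the member-level letters the assembler has at the matrix fibre: `hE` (G′, p33 FILE 9), `hEO` (the `O_□`,
p38 `eBlock_locLetterBY''`), `hCinv` + `hX` (p21 FILE 10-D, `isUnit_XY_parSymY`), `hU` (Thm 3.11), bi-contractive transporters at `U₁` and at the gauged cube
configurations `V′_□` (`hpar`, `hparV`).

WHAT THIS FILE PROVES (theorems only; 0 `def`, 0 `def … : Prop`, 0 sorry; standard axioms).
* §0 `scaleTransfer_len_inv_pow_geo9K` — [4] (2.60) for the weights `(Lʲη)⁻ⁿ` under `n·log L ≤ αδ(2L²−1)M` (`transferL_geo9K` at `q = −n`; the `n = 1, 3` cases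
  were not in the tree), `exp_collar_le` (the collar factors against one); print's units `η = L^{−k}` are p33 FILE 9's `etaS_eq_kGeo_eta_of_cf`.
* §1 ★★★ `famThree_at_member` — the package described above.

HONEST SCOPE.  Pure ∃-bookkeeping over landed theorems; no estimate is added and no displayed analytic input of the record is removed other than by its landed
supplier.  DISPLAYED: `hE`, `hEO`, `hCinv`, `hU`, `hX`, `hpar`, `hparV`, `η = |c_f|⁻¹` via `c_f = L^k`, the section `ιB`, the twelve cube-data clauses with
bi-contractive gauges.  NOT here: the transposed twin (`hV′`, file P3T), the knit into `hrest` (ASM1), the smallness threshold (ASM2).  Count-neutral; no summit ∕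
node statement proved; nothing continuum ∕ OS ∕ mass gap ∕ Clay; YM mass gap NOT proved (Track A conditional rung).  `--supports stmt-QuantumFields-19200`.

RELATED IN THE TREE, NOT DUPLICATED (searched 2026-08-29: `lean search 'famThree_at_member|FamThreeAtMember' --decl` = ∅): the record and FILES 8a∕8b∕8c, E3f, p21
`B9Cor36CinvCubeAtLocCfg`, p33 `B9Cor36GpCubeEntriesAtV`, `B9GeoInputsMultiRateKLevelV1`, `B9CubeGeometryInputs`, p33 FILE 9 `B9Cor36GpCoverBindersUnitary`
(`etaS_eq_kGeo_eta_of_cf`) — all USED BY NAME.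
-/

noncomputable section

open scoped BigOperators

namespace Literature.MathematicalPhysics.QuantumFieldTheory.Balaban1983to89.B9Eq3105FamThreeAtMember

open NormedSpace Complex
open B6RandomWalk (HasMajorant hasMajorant_mono Ineq261 c1_nonneg)
open B6RandomWalkHom (HasMajorantHom)
open B9Thm34Ext (toB6)
open B9FromB6 (EBlock)
open B9Ineq347 (ScaleTransfer)
open B9Eq352DivFormLetters (conj)
open B9Eq352GradLetters (diffLetter)
open B9Eq376POneLetters (conjHom)
open B9Eq39Adjoint (fluct covD)
open B9Eq360DeltaPrimeAY (AfldY)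
open B9Eq360DeltaPrimeACubeY (blkCubeY)
open B6KLevelCensusIndexV1 (KIdx kGeo)
open B6Cover236MultiLevelBlocks (cubes)
open B6GlobalChartV1 (PV boxEquiv blkV1)
open B6Geom246MultiLevelBox (blkOf)
open B6Ineq2142KLevelV1 (β)
open B9GeoNormsKLevelV1 (geo9K)
open B9GeoLemma21KLevelV1 (transferL_geo9K geo9K_len_pos one_le_Mh)
open B9GeoInputsMultiRateKLevelV1 (ineq261_three_geo9K scaleTransfer_len_sq_geo9K scaleTransfer_len_inv4_geo9K)
open B9Cor36GCubeLocDefectAtLocCfg (scaleTransfer_len_geo9K)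
open B9RWSums347DefiniteFaces (exp261)
open B9RWSums347DefiniteFacesWindow (scaleTransfer_mono_const)
open B9BackgroundsKLevelV1 (shiftsV1)
open B9CubeGeometryInputs (geoCK geoCK_dist_axioms RM1 N1 exists_h261_geoCK hST_geoCK)
open B9CubeLettersOpsL0 (deltaPrimeACubeY GpCubeY)
open B9CubeLettersBondOpsL0 (QpCubeY QpsCubeY XCubeY XinvCubeY BlkCubeY)
open B9CubeLettersInvReadings (kernelFamilySInv kernelFamilyBInv)
open B9Thm37CubeCoverCommutators (cutMulY hTY)
open B4PartitionUnity22 (thetaProf D1 D1_nonneg contDiff_thetaProf hasCompactSupport_thetaProf)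
open B9Cor36CutoffField337 (bumpY)
open B9Cor36CubeCutoffs (SC NearC chiY ctrR locCfgY one_le_SC)
open B9Eq359CubeKernelsAtOne (Cq Cq_nonneg)
open B9Cor35CinvAtCubeLetters (kernel_rate_mono)
open B9Eq3104CutoffCommutators (hBdY DPDsY)
open B9Eq3105ZetaY (zetaY)
open B9Cor36GCubeLocLetter (locProjBY)
open B9Cor36GpCubeExtAtV (GpVK)
open B9Cor36GpCubeEntriesAtV (gp_cube_entries_at_locCfg)
open B9Cor36CinvCubeAtLocCfg (cinv_cube_at_locCfg)
open B9Thm37Sum (mulOp mulOp_apply)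
open B9Eq3105FamThreeAtLocCfgOfTailsClosed (hasMajorant_sum_famThree_at_locCfg_of_tails_closed)
open B9Eq3105FamThreeCommStepAtDatum (isUnit_deltaPrimeACubeY_gauge_inv)
open B9Eq3105FamThreeCommStepAdjAtDatum (hasMajorant_conj_commStepAdj_member_rate)
open B9Eq3105FamThreeCommStepsAtDatum (commSteps_at_datum kernel_weaken)
open B9Eq3105FamThreeLocCDiffOuterEntries (hasMajorant_rightEntry_at hasMajorant_leftEntry_at)
open B9Eq3105FamThreeLocCDiffCubeTails (hasMajorant_tail0_at hasMajorant_tail1_at hasMajorant_tail2_at hasMajorant_sbL_at hasMajorant_gw_at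
  hasMajorant_projCube_member)
open B9Eq3105FamThreeLocCDiffCubeTailsGK (hasMajorant_tk_at)
open B9Eq3105FamThreeLocCDiffCubeTailsGK.CubeData (GpVK_eq_conj_smul hasMajorant_resolventCube_of_cinv isUnit_XCubeY_gauge)
open Node00 (SiteY BlkY IBondY FBondY CfgY GaugeY SiteOpY BondOpY SiteParY BondParY toKT shiftY UboxY GpY deltaPrimeAY gaugeY parSymY
  parSymY_isGaugeLawS etaS QpY QpsY XY XinvY)

variable {d ℓ : ℕ} {hd : 1 ≤ d + 1} {hL : Odd (ℓ + 1) ∧ 1 < ℓ + 1} {b₀ b₁ : ℝ}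
variable {𝔸 : Type} [NormedRing 𝔸] [NormedAlgebra ℂ 𝔸] [CompleteSpace 𝔸]
variable {ι : Type} [Fintype ι]

/-! ## §0  Geometry and units -/

/-- ★ **SCALE TRANSFER FOR THE WEIGHTS `(Lʲη)⁻ⁿ`**: under `n·log L ≤ αδ(2L²−1)M` (`αδ > 0`), `e^{−αδd(y,y′)}(L^{j′}η)⁻ⁿ ≤ Lⁿ(Lʲη)⁻ⁿ` for all `y, y′`
(`transferL_geo9K` at `q = −n`).  [cite: Balaban1985BackgroundPropagators, p.398 remark after (3.47); Balaban1984PropagatorsII, Lemma 2.1 (2.60) p.234] -/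
theorem scaleTransfer_len_inv_pow_geo9K (i : KIdx d ℓ hd hL b₀ b₁) (n : ℕ) {δ α : ℝ} (hε : 0 < α * δ)
    (hM : (n : ℝ) * Real.log ((ℓ : ℝ) + 1) ≤ α * δ * (2 * ((ℓ : ℝ) + 1) ^ 2 - 1) * (geo9K i).M) :
    ScaleTransfer (geo9K i) δ α (((ℓ : ℝ) + 1) ^ n) (fun a => ((geo9K i).len a ^ n)⁻¹) := by
  have geo9K_L_eq : (geo9K i).L = (ℓ : ℝ) + 1 := by
    show (((ℓ + 1 : ℕ) : ℝ)) = (ℓ : ℝ) + 1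
    push_cast; ring
  have hn : |(-(n : ℝ))| = n := by rw [abs_neg, Nat.abs_cast]
  have hq : |(-(n : ℝ))| * Real.log (geo9K i).L ≤ α * δ * (2 * ((ℓ : ℝ) + 1) ^ 2 - 1) * (geo9K i).M := by
    rw [hn, geo9K_L_eq]; exact hM
  have hT := transferL_geo9K i hε (-(n : ℝ)) hq
  have hC : (geo9K i).L ^ |(-(n : ℝ))| = ((ℓ : ℝ) + 1) ^ n := by rw [hn, geo9K_L_eq, Real.rpow_natCast]
  have e : ∀ y : (geo9K i).Site, (geo9K i).len y ^ (-(n : ℝ)) = ((geo9K i).len y ^ n)⁻¹ := fun y => by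
    rw [Real.rpow_neg (geo9K_len_pos i y).le, Real.rpow_natCast]
  intro y y'
  have h := hT y y'
  rw [e, e, hC] at h
  have hE : 0 < Real.exp (α * δ * (geo9K i).dist y y') := Real.exp_pos _
  rw [Real.exp_neg, inv_mul_le_iff₀ hE]
  calc ((geo9K i).len y' ^ n)⁻¹ ≤ ((ℓ : ℝ) + 1) ^ n * Real.exp (α * δ * (geo9K i).dist y y') * ((geo9K i).len y ^ n)⁻¹ := h
    _ = Real.exp (α * δ * (geo9K i).dist y y') * (((ℓ : ℝ) + 1) ^ n * ((geo9K i).len y ^ n)⁻¹) := by ring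

/-- the collar factors against one: for `0 ≤ a₀ ≤ a`, `k ≤ 3` and `8 ≤ M_h`, `e^{−a(3M_h∕8 − k)} ≤ e^{−a₀(3M_h∕8 − 3)}`.
[cite: Balaban1985BackgroundPropagators, p.411 l.36–41 («e^{−(1∕4)δ₀M}»), bookkeeping] -/
theorem exp_collar_le {a a₀ k Mh : ℝ} (ha₀ : 0 ≤ a₀) (ha : a₀ ≤ a) (hk : k ≤ 3) (hMh : 8 ≤ Mh) :
    Real.exp (-(a * (3 / 8 * Mh - k))) ≤ Real.exp (-(a₀ * (3 / 8 * Mh - 3))) := by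
  refine Real.exp_le_exp.mpr ?_
  have h1 : 0 ≤ 3 / 8 * Mh - 3 := by linarith
  have h2 : 3 / 8 * Mh - 3 ≤ 3 / 8 * Mh - k := by linarith
  nlinarith [mul_le_mul ha h2 h1 (ha₀.trans ha)]

/-! ## §1 ★★★ Family 3 of (3.105) as an ∃-threshold package at the member -/

set_option maxHeartbeats 16000000 in
/-- ★★★ **FAMILY 3 OF (3.105) AT THE MEMBER, ∃-THRESHOLD PACKAGE** (p. 414 (3.105) third sum `Σ_□ζ_□̃(DPD* − DP_□D*)h_□G_□h_□` at the located projection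
letters of record, p. 415 l. 26–37, p. 411 «e^{−(1∕4)δ₀M}»).  For block rates∕constants `δ_G, δ_X, δ_O > 0`, `B_G, B₁, B_O ≥ 0` of `G′`, `(Q′G′²Q′*)⁻¹`, `O_□`,
a real basis `b` with coordinate bound `M₂` and walk letters `Rr, Hp`, there are MEMBER-INDEPENDENT `ρ₃, κ₃ > 0`, `Θ₃ ≥ 0`, thresholds `M₀ T₀ N₀` and a (3.37) size
`a₁ > 0` such that: at every member above the thresholds with `c_f = L^k`, for every family of per-cube (3.35) data (bi-contractive gauges `u_□`, potentials `A_□`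
on torus sets `Q_□ ⊇ NearC_□(35S_j∕8 + 1)` with `U^{u_□} = e^{iηA_□}` on their bonds, `‖A_□‖ ≦ C_□ξ_□⁻¹`, `‖η⁻¹∂A_□‖ ≦ C_□ξ_□⁻²`, `0 < ξ_□ ≦ 5S_jη`,
`L^{j+1}η ≦ Λ_□ξ_□`, `1 ≦ Λ_□`, `max C_□ (C_□(1+D₁θ))Λ_□² ≦ min(a₁, ¼)`), every background family through `U`, every bond-sector cube-letter family `O_□` and
section `ιB`, GIVEN the member-level letters' data `hE`, `hEO`, `hpar`, `hCinv`, `hU`, `hX`, `hparV`: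
`Σ_□ conj b((M_{ζ_□̃}·(DPD*(U₁) − P_{□,loc}(V′_□))·(M_{h_□}O_□M_{h_□}))^ℝ) ≺ Θ₃·e^{−κ₃M_h}·e^{−ρ₃d}` on `(f, j) ↦ ιB(Δf₋)` — the record
`hasMajorant_sum_famThree_at_locCfg_of_tails_closed` with every cube-side letter, located tail, (2.61), scale transfer and rate budget DISCHARGED.
[cite: Balaban1985BackgroundPropagators, (3.105)–(3.106) p.414, p.415 l.26–37, p.411 l.36–41, Cor. 3.6 p.408, Thm 3.10 p.416; Balaban1984PropagatorsII, Lemma 2.1 (2.60)–(2.61) p.234] -/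
theorem famThree_at_member [NormOneClass 𝔸] [DecidableEq ι]
    [∀ i' : KIdx d ℓ hd hL b₀ b₁, Fintype (geo9K i').Site] [∀ i' : KIdx d ℓ hd hL b₀ b₁, DecidableEq (geo9K i').Site]
    (Rr : KIdx d ℓ hd hL b₀ b₁ → ℝ) (Hp : KIdx d ℓ hd hL b₀ b₁ → Prop) (b : Module.Basis ι ℝ 𝔸) (hℓ : 1 ≤ ℓ) {M₂ : ℝ} (hM₂ : 0 ≤ M₂)
    (hrepr : ∀ (v : 𝔸) (j : ι), |b.repr v j| ≤ M₂ * ‖v‖)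
    {δG δX δO BG B₁ BO : ℝ} (hδG : 0 < δG) (hδX : 0 < δX) (hδO : 0 < δO) (hBG : 0 ≤ BG) (hB₁ : 0 ≤ B₁) (hBO : 0 ≤ BO) :
    ∃ ρ₃ κ₃ Θ₃ M₀ T₀ : ℝ, ∃ N₀ : ℕ, 0 < ρ₃ ∧ 0 < κ₃ ∧ 0 ≤ Θ₃ ∧ ∃ a₁ : ℝ, 0 < a₁ ∧
    ∀ (i : KIdx d ℓ hd hL b₀ b₁),
      M₀ ≤ ((ℓ : ℝ) + 1) * (toKT i).Mh → N₀ + 1 ≤ (toKT i).R * ((ℓ + 1) * (toKT i).Mh) → T₀ ≤ RM1 i → i.cf = (((ℓ + 1 : ℕ) : ℝ)) ^ i.k →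
    ∀ (U : CfgY 𝔸 i) (u : ↥(cubes (toKT i).D.toDomains) → GaugeY 𝔸 i),
      (∀ c x, ‖((u c x : 𝔸ˣ) : 𝔸)‖ ≤ 1 ∧ ‖(((u c x)⁻¹ : 𝔸ˣ) : 𝔸)‖ ≤ 1) →
    ∀ (A : ↥(cubes (toKT i).D.toDomains) → AfldY 𝔸 i)
      (Q : ↥(cubes (toKT i).D.toDomains) → Set (Site (PV d ℓ i.m i.K hd hL) 0)) (C ξ Λ : ↥(cubes (toKT i).D.toDomains) → ℝ),
      (∀ c, 0 ≤ C c) → (∀ c, 0 < ξ c) → (∀ c, 1 ≤ Λ c) → (∀ c, ξ c ≤ 5 * (SC i c : ℝ) * (kGeo i).eta) →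
      (∀ c, LatticeNorms.scaleLen ((ℓ : ℝ) + 1) (kGeo i).eta (c.1.1 + 1) ≤ Λ c * ξ c) →
      (∀ c, ∀ x : Site (PV d ℓ i.m i.K hd hL) 0, NearC i c (35 * SC i c / 8 + 1) (boxEquiv i.hN x).1 → x ∈ Q c) →
      (∀ c, ∀ (κ : Fin (d + 1)) (x : Site (PV d ℓ i.m i.K hd hL) 0), x ∈ Q c → x.shift κ ∈ Q c →
        gaugeY i (u c) U κ x = fluct (kGeo i).eta (A c) κ x) →
      (∀ c, ∀ κ, ∀ x ∈ Q c, ‖A c κ x‖ ≤ C c * (ξ c)⁻¹) →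
      (∀ c, ∀ μ ν, ∀ x ∈ Q c, ‖(((kGeo i).eta : ℂ)⁻¹) • covD (shiftsV1 (PV d ℓ i.m i.K hd hL)) (fun _ _ => (1 : 𝔸ˣ)) μ (A c ν) x‖ ≤ C c * (ξ c ^ 2)⁻¹) →
      (∀ c, max (C c) (C c * (1 + D1 thetaProf)) * Λ c ^ 2 ≤ a₁) → (∀ c, max (C c) (C c * (1 + D1 thetaProf)) * Λ c ^ 2 ≤ 1 / 4) →
    ∀ {B : B9.Backgrounds} (cfg : B.Cfg → CfgY 𝔸 i) (par : BondParY 𝔸 i) (U₁ : B.Cfg), cfg U₁ = U →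
    ∀ (_ : EBlock (kernelFamilySInv i B cfg (fun W => GpY i (parSymY i) W) (parSymY i)) BG δG U₁)
      (Oc : ↥(cubes i.D.toDomains) → BondOpY 𝔸 i) (_ : ∀ c : ↥(cubes i.D.toDomains), EBlock (kernelFamilyBInv i B cfg (Oc c) par) BO δO U₁)
      (ιB : BlkY i → IBondY i) (_ : ∀ s, β i.hN i.D i.hk (ιB s) = s)
      (_ : ∀ z w : SiteY i, ‖(parSymY i (cfg U₁) z w : 𝔸)‖ ≤ 1 ∧ ‖(((parSymY i (cfg U₁) z w)⁻¹ : 𝔸ˣ) : 𝔸)‖ ≤ 1)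
      (_ : HasMajorant (g := toB6 (geo9K i) (Rr i) (Hp i)) (fun q : BlkY i × ι => ιB q.1)
        (conj b (((etaS i ^ 2 * etaS i ^ 2)⁻¹) • (XinvY i (parSymY i) (fun W => GpY i (parSymY i) W) (cfg U₁)).restrictScalars ℝ))
        (fun a a' => B₁ * ((geo9K i).len a ^ 4)⁻¹ * Real.exp (-(δX * (geo9K i).dist a a'))))
      (_ : IsUnit (deltaPrimeAY i (parSymY i) (cfg U₁)))
      (_ : IsUnit (XY i (parSymY i) (fun W => GpY i (parSymY i) W) (cfg U₁)))
      (_ : ∀ (c : ↥(cubes i.D.toDomains)) (z w : SiteY i),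
        ‖(parSymY i (gaugeY i (u c)⁻¹ (locCfgY i c (kGeo i).eta (A c))) z w : 𝔸)‖ ≤ 1 ∧
          ‖(((parSymY i (gaugeY i (u c)⁻¹ (locCfgY i c (kGeo i).eta (A c))) z w)⁻¹ : 𝔸ˣ) : 𝔸)‖ ≤ 1),
    HasMajorant (g := toB6 (geo9K i) (Rr i) (Hp i)) (fun p : FBondY i × ι => ιB (blkV1 i.hN i.D p.1))
      (∑ c : ↥(cubes i.D.toDomains), conj b ((cutMulY (𝔸 := 𝔸) (hBdY i (zetaY i c)) *
        (DPDsY i (parSymY i) (fun W => GpY i (parSymY i) W) (cfg U₁) - locProjBY i c (parSymY i) (u c) (locCfgY i c (kGeo i).eta (A c))) *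
        (cutMulY (𝔸 := 𝔸) (hBdY i (hTY i c)) * Oc c (cfg U₁) * cutMulY (𝔸 := 𝔸) (hBdY i (hTY i c)))).restrictScalars ℝ))
      (fun a a' => Θ₃ * Real.exp (-(κ₃ * ((toKT i).Mh : ℝ))) * Real.exp (-(ρ₃ * (geo9K i).dist a a'))) := by
  classical
  have hL1 : (1 : ℝ) ≤ (ℓ : ℝ) + 1 := by linarith [(Nat.cast_nonneg ℓ : (0 : ℝ) ≤ ℓ)]
  have hL0 : (0 : ℝ) < (ℓ : ℝ) + 1 := by positivity
  have hlog : 0 ≤ Real.log ((ℓ : ℝ) + 1) := Real.log_nonneg hL1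
  have h2L : (0 : ℝ) < 2 * ((ℓ : ℝ) + 1) ^ 2 - 1 := by nlinarith
  have hSb : 0 ≤ ∑ j, ‖b j‖ := Finset.sum_nonneg fun _ _ => norm_nonneg _
  have hS : 0 ≤ M₂ * ∑ j, ‖b j‖ := mul_nonneg hM₂ hSb
  have hD1 : 0 ≤ D1 thetaProf := D1_nonneg contDiff_thetaProf hasCompactSupport_thetaProf
  have hCq : 0 ≤ Cq d := Cq_nonneg d
  -- ═══ the three per-cube ∃-packages ═══
  obtain ⟨δS, θS, M₀S, T₀S, N₀S, hδS, hθS, a₁S, ha₁S, HS⟩ := commSteps_at_datum b d ℓ hℓ hM₂ hrepr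
  obtain ⟨δC, BC, M₀C, T₀C, N₀C, hδC, hBC, a₁C, ha₁C, HC⟩ := cinv_cube_at_locCfg b d ℓ hℓ M₂ hM₂ hrepr
  obtain ⟨δB, Bf, M₀B, T₀B, N₀B, hδB, hBf, a₁B, ha₁B, HB⟩ := gp_cube_entries_at_locCfg b d ℓ hℓ M₂ hM₂ hrepr
  -- ═══ the unit rate `m` ═══
  obtain ⟨m, hmdef⟩ : ∃ m : ℝ, m = min δG (min δX (min δO (min δS (min δC δB)))) := ⟨_, rfl⟩
  have hm : 0 < m := by rw [hmdef]; exact lt_min hδG (lt_min hδX (lt_min hδO (lt_min hδS (lt_min hδC hδB))))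
  have hmG : m ≤ δG := by rw [hmdef]; exact min_le_left _ _
  have hmX : m ≤ δX := by rw [hmdef]; exact (min_le_right _ _).trans (min_le_left _ _)
  have hmO : m ≤ δO := by rw [hmdef]; exact ((min_le_right _ _).trans (min_le_right _ _)).trans (min_le_left _ _)
  have hmS : m ≤ δS := by
    rw [hmdef]; exact (((min_le_right _ _).trans (min_le_right _ _)).trans (min_le_right _ _)).trans (min_le_left _ _)
  have hmC : m ≤ δC := by
    rw [hmdef]
    exact ((((min_le_right _ _).trans (min_le_right _ _)).trans (min_le_right _ _)).trans (min_le_right _ _)).trans (min_le_left _ _)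
  have hmB : m ≤ δB := by
    rw [hmdef]
    exact ((((min_le_right _ _).trans (min_le_right _ _)).trans (min_le_right _ _)).trans (min_le_right _ _)).trans (min_le_right _ _)
  -- ═══ the cube (2.61)s ═══
  obtain ⟨dBS, h261S⟩ := exists_h261_geoCK d ℓ hδS
  obtain ⟨dBCc, h261Cc⟩ := exists_h261_geoCK d ℓ hδC
  obtain ⟨dBBc, h261Bc⟩ := exists_h261_geoCK d ℓ hδB
  -- ═══ the member (2.61)s: six rate pairs ═══
  obtain ⟨r', hr'def⟩ : ∃ r' : ℝ, r' = 1 / 16 * m / δO := ⟨_, rfl⟩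
  have hr' : 0 < r' := by rw [hr'def]; positivity
  obtain ⟨ρ', hρ'def⟩ : ∃ ρ' : ℝ, ρ' = min (r' / 2) (1 / 2) := ⟨_, rfl⟩
  have hρ' : 0 < ρ' := by rw [hρ'def]; exact lt_min (by positivity) (by norm_num)
  have hρ'r : ρ' ≤ r' / 2 := by rw [hρ'def]; exact min_le_left _ _
  have hρ'2 : ρ' ≤ 1 / 2 := by rw [hρ'def]; exact min_le_right _ _
  have hp₁ : 0 < 1 / 8 * (1 / 8 * m) := by positivity
  have hp₂ : 0 < (m / (4 * δG) - m / (8 * δG)) * δG := by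
    have : (m / (4 * δG) - m / (8 * δG)) * δG = m / 8 := by field_simp; ring
    rw [this]; positivity
  have hp₃ : 0 < (1 - 1 / 8 - 1 / 8 - 1 / 8) * m := by positivity
  have hp₄ : 0 < 1 / 256 * m := by positivity
  have hp₅ : 0 < (1 - ρ') * δO := mul_pos (by linarith only [hρ'2]) hδO
  have hp₆ : 0 < 1 / 32 * m := by positivity
  obtain ⟨ML₁, hgeo₁⟩ := ineq261_three_geo9K Rr Hp hp₁ hp₂ hp₃
  obtain ⟨ML₂, hgeo₂⟩ := ineq261_three_geo9K Rr Hp hp₄ hp₅ hp₆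
  set e11 : ℕ := exp261 (geo9K (d := d) (ℓ := ℓ) (hd := hd) (hL := hL) (b₀ := b₀) (b₁ := b₁)) (1 / 8 * m) (1 / 8) with he11
  set e12 : ℕ := max (exp261 (geo9K (d := d) (ℓ := ℓ) (hd := hd) (hL := hL) (b₀ := b₀) (b₁ := b₁)) δG (m / (4 * δG) - m / (8 * δG)))
    (exp261 (geo9K (d := d) (ℓ := ℓ) (hd := hd) (hL := hL) (b₀ := b₀) (b₁ := b₁)) m (1 - 1 / 8 - 1 / 8 - 1 / 8)) with he12
  set e21 : ℕ := exp261 (geo9K (d := d) (ℓ := ℓ) (hd := hd) (hL := hL) (b₀ := b₀) (b₁ := b₁)) m (1 / 256) with he21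
  set e22 : ℕ := max (exp261 (geo9K (d := d) (ℓ := ℓ) (hd := hd) (hL := hL) (b₀ := b₀) (b₁ := b₁)) δO (1 - ρ'))
    (exp261 (geo9K (d := d) (ℓ := ℓ) (hd := hd) (hL := hL) (b₀ := b₀) (b₁ := b₁)) m (1 / 32)) with he22
  have hcS : 0 ≤ B6.c1 dBS δS (1 / 2) := c1_nonneg _ _ _
  have hcCc : 0 ≤ B6.c1 dBCc δC (1 / 2) := c1_nonneg _ _ _
  have hcBc : 0 ≤ B6.c1 dBBc δB (1 / 2) := c1_nonneg _ _ _
  have hc11 : 0 ≤ B6.c1 e11 (1 / 8 * m) (1 / 8) := c1_nonneg _ _ _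
  have hc12G : 0 ≤ B6.c1 e12 δG (m / (4 * δG) - m / (8 * δG)) := c1_nonneg _ _ _
  have hc12m : 0 ≤ B6.c1 e12 m (1 - 1 / 8 - 1 / 8 - 1 / 8) := c1_nonneg _ _ _
  have hc21 : 0 ≤ B6.c1 e21 m (1 / 256) := c1_nonneg _ _ _
  have hc22O : 0 ≤ B6.c1 e22 δO (1 - ρ') := c1_nonneg _ _ _
  have hc22t : 0 ≤ B6.c1 e22 m (1 / 32) := c1_nonneg _ _ _
  -- ═══ the member-independent constants (opaque names with defining equations) ═══
  obtain ⟨BS, hBSdef⟩ : ∃ x : ℝ, x = ((M₂ * ∑ j, ‖b j‖) * (1 + Cq d * (1 / 4))) ^ 2 * BC := ⟨_, rfl⟩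
  have hBS : 0 ≤ BS := by rw [hBSdef]; positivity
  have hθK : 0 ≤ (M₂ * ∑ j, ‖b j‖) ^ 2 * (θS * B6.c1 dBS δS (1 / 2)) := by positivity
  obtain ⟨κL, hκLdef⟩ : ∃ x : ℝ, x = (M₂ * ∑ j, ‖b j‖) * BG * (1 + D1 thetaProf / 3) * (1 + (M₂ * ∑ j, ‖b j‖) ^ 2 * (θS * B6.c1 dBS δS (1 / 2)) * B6.c1 e22 m (1 / 32)) := ⟨_, rfl⟩
  have hκL : 0 ≤ κL := by rw [hκLdef]; positivity
  obtain ⟨κR, hκRdef⟩ : ∃ x : ℝ, x = ((M₂ * ∑ j, ‖b j‖) * BG + (M₂ * ∑ j, ‖b j‖) * BG * ((ℓ : ℝ) + 1) * (D1 thetaProf / 3)) * (1 + (M₂ * ∑ j, ‖b j‖) ^ 2 * (θS * B6.c1 dBS δS (1 / 2)) * ((ℓ : ℝ) + 1) * B6.c1 e22 m (1 / 32)) := ⟨_, rfl⟩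
  have hκR : 0 ≤ κR := by rw [hκRdef]; positivity
  obtain ⟨κT0, hκT0def⟩ : ∃ x : ℝ, x = (M₂ * ∑ j, ‖b j‖) ^ 2 * (BS * ((ℓ : ℝ) + 1) ^ 4) * ((ℓ : ℝ) + 1) ^ 4 * κR * ((ℓ : ℝ) + 1) * B6.c1 e22 m (1 / 32) := ⟨_, rfl⟩
  have hκT0 : 0 ≤ κT0 := by rw [hκT0def]; positivity
  obtain ⟨κT1, hκT1def⟩ : ∃ x : ℝ, x = (M₂ * ∑ j, ‖b j‖) ^ 2 * (Bf * B6.c1 dBBc δB (1 / 2)) * κT0 * ((ℓ : ℝ) + 1) ^ 3 * B6.c1 e22 m (1 / 32) := ⟨_, rfl⟩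
  have hκT1 : 0 ≤ κT1 := by rw [hκT1def]; positivity
  obtain ⟨κT2, hκT2def⟩ : ∃ x : ℝ, x = (M₂ * ∑ j, ‖b j‖) ^ 2 * (Bf * B6.c1 dBBc δB (1 / 2)) * ((M₂ * ∑ j, ‖b j‖) ^ 2 * (Bf * B6.c1 dBBc δB (1 / 2))) * ((ℓ : ℝ) + 1) ^ 2 * B6.c1 e22 m (1 / 32) * κT0 * ((ℓ : ℝ) + 1) ^ 3 * B6.c1 e22 m (1 / 32) := ⟨_, rfl⟩
  have hκT2 : 0 ≤ κT2 := by rw [hκT2def]; positivity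
  obtain ⟨κSb, hκSbdef⟩ : ∃ x : ℝ, x = (M₂ * ∑ j, ‖b j‖) ^ 2 * (BS * B6.c1 dBCc δC (1 / 2)) := ⟨_, rfl⟩
  have hκSb : 0 ≤ κSb := by rw [hκSbdef]; positivity
  obtain ⟨κK, hκKdef⟩ : ∃ x : ℝ, x = (M₂ * ∑ j, ‖b j‖) ^ 2 * ((BS * θS * 1 * B6.c1 dBCc δC (1 / 2)) * ((ℓ : ℝ) + 1) ^ 4) * ((ℓ : ℝ) + 1) ^ 4 := ⟨_, rfl⟩
  have hκK : 0 ≤ κK := by rw [hκKdef]; positivity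
  obtain ⟨κG, hκGdef⟩ : ∃ x : ℝ, x = ((M₂ * ∑ j, ‖b j‖) ^ 2 * (BS * ((ℓ : ℝ) + 1) ^ 4) * ((ℓ : ℝ) + 1) ^ 4 + κK) * ((M₂ * ∑ j, ‖b j‖) * BG + (M₂ * ∑ j, ‖b j‖) * BG * ((ℓ : ℝ) + 1) * (D1 thetaProf / 3)) * ((ℓ : ℝ) + 1) * B6.c1 e22 m (1 / 32) := ⟨_, rfl⟩
  have hκG : 0 ≤ κG := by rw [hκGdef]; positivity
  have hκPb : 0 ≤ (M₂ * ∑ j, ‖b j‖) ^ 2 := by positivity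
  -- the collar-free budget constants (collar factors replaced by `1`)
  obtain ⟨εT1, hεT1def⟩ : ∃ x : ℝ, x = ((M₂ * ∑ j, ‖b j‖) * BG * (1 + D1 thetaProf / 3)) * (1 + ((M₂ * ∑ j, ‖b j‖) ^ 2 * (θS * B6.c1 dBS δS (1 / 2))) * B6.c1 e12 δG (m / (4 * δG) - m / (8 * δG)) * 1) + ((M₂ * ∑ j, ‖b j‖) * BG * (1 + ((ℓ : ℝ) + 1) * (D1 thetaProf / 3))) * (1 + ((M₂ * ∑ j, ‖b j‖) ^ 2 * (θS * B6.c1 dBS δS (1 / 2))) * ((ℓ : ℝ) + 1) * B6.c1 e12 m (1 - 1 / 8 - 1 / 8 - 1 / 8) * 1) := ⟨_, rfl⟩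
  have hεT1 : 0 ≤ εT1 := by rw [hεT1def]; positivity
  obtain ⟨ε31, hε31def⟩ : ∃ x : ℝ, x = ((d : ℝ) + 1) * (κL * ((M₂ * ∑ j, ‖b j‖) ^ 2 * B₁) * (M₂ * ∑ j, ‖b j‖) ^ 2 * κT2 * (((ℓ : ℝ) + 1) ^ 4 * ((ℓ : ℝ) + 1)) * B6.c1 e21 m (1 / 256) ^ 2 * 1 + κL * ((M₂ * ∑ j, ‖b j‖) ^ 2 * B₁) * (M₂ * (∑ j, ‖b j‖) * BG) ^ 2 * (M₂ * ∑ j, ‖b j‖) ^ 2 * κT0 * (((ℓ : ℝ) + 1) ^ 4 * (((ℓ : ℝ) + 1) ^ 2) ^ 2 * ((ℓ : ℝ) + 1) ^ 3) * B6.c1 e21 m (1 / 256) ^ 4 * 1 + κL * ((M₂ * ∑ j, ‖b j‖) ^ 2 * B₁) * (M₂ * (∑ j, ‖b j‖) * BG) ^ 2 * ((M₂ * ∑ j, ‖b j‖) ^ 2 * (θS * B6.c1 dBS δS (1 / 2))) * κT0 * (((ℓ : ℝ) + 1) ^ 4 * (((ℓ : ℝ) + 1) ^ 2) ^ 2 *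 ((ℓ : ℝ) + 1) ^ 3) * B6.c1 e21 m (1 / 256) ^ 5 * 1 + κL * ((M₂ * ∑ j, ‖b j‖) ^ 2 * B₁) * (M₂ * (∑ j, ‖b j‖) * BG) * ((M₂ * ∑ j, ‖b j‖) ^ 2 * (θS * B6.c1 dBS δS (1 / 2))) * κT1 * (((ℓ : ℝ) + 1) ^ 4 * ((ℓ : ℝ) + 1) ^ 2 * ((ℓ : ℝ) + 1)) * B6.c1 e21 m (1 / 256) ^ 4 * 1 + κL * ((M₂ * ∑ j, ‖b j‖) ^ 2 * B₁) * κR * (((ℓ : ℝ) + 1) ^ 4 * ((ℓ : ℝ) + 1)) * B6.c1 e21 m (1 / 256) ^ 2 * 1 + κL * κSb * κR * (((ℓ : ℝ) + 1) ^ 4 * ((ℓ : ℝ) + 1)) * B6.c1 e21 m (1 / 256) ^ 2 * 1 + κL * 1 * (((M₂ * ∑ j, ‖b j‖) ^ 2 * B₁) * κR * ((ℓ : ℝ) + 1) * B6.c1 e21 m (1 / 256)) * ((ℓ : ℝ) + 1) ^ 3 * B6.c1 e21 m (1 / 256) + κL * 1 * κG * ((ℓ : ℝ) + 1) ^ 3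 * B6.c1 e21 m (1 / 256)) := ⟨_, rfl⟩
  have hε31 : 0 ≤ ε31 := by rw [hε31def]; positivity
  obtain ⟨Θ₃, hΘ₃def⟩ : ∃ x : ℝ, x = (3 * 5 ^ (d + 1)) * (((M₂ * ∑ j, ‖b j‖) * (M₂ * ∑ j, ‖b j‖) * B₁ * (((ℓ : ℝ) + 1) ^ 4) ^ 4 * B6.c1 e11 (1 / 8 * m) (1 / 8) ^ 2 * (((d : ℝ) + 1) * εT1 * (2 * ((M₂ * ∑ j, ‖b j‖) * BG) + εT1)) + ε31) * ((M₂ * ∑ j, ‖b j‖) * BO) * ((ℓ : ℝ) + 1) ^ 2 * B6.c1 e22 δO (1 - ρ')) * Real.exp (3 / 128 * m * 3) := ⟨_, rfl⟩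
  have hΘ₃ : 0 ≤ Θ₃ := by rw [hΘ₃def]; positivity
  -- ═══ the package ═══
  refine ⟨ρ' * δO, 3 / 128 * m * (3 / 8), Θ₃,
    max (max M₀S (max M₀C M₀B)) (max ML₁ (max ML₂ (1024 * Real.log ((ℓ : ℝ) + 1) / (m * (2 * ((ℓ : ℝ) + 1) ^ 2 - 1))))),
    max (max T₀S (max T₀C T₀B)) (4 * Real.log ((ℓ : ℝ) + 1) / (9 / 5000 * (m / 2))),
    max (max N₀S (max N₀C N₀B)) (max (N1 d ℓ (9 / 5000 * δS)) (max (N1 d ℓ (9 / 5000 * δC)) (N1 d ℓ (9 / 5000 * δB)))),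
    by positivity, by positivity, hΘ₃, min a₁S (min a₁C a₁B), lt_min ha₁S (lt_min ha₁C ha₁B), ?_⟩
  intro i hM hN hT hcf U u hu A Q C ξ Λ hC0 hξ hΛ hξS hΛξ hQ hgA hAb hdA hs₁ hs₄ B cfg par U₁ hcfg hE Oc hEO ιB hι hpar hCinv hU hX hparV
  subst hcfg
  -- ─── thresholds ───
  have hMg : (geo9K i).M = ((ℓ : ℝ) + 1) * ((toKT i).Mh : ℝ) := by
    show (((ℓ + 1 : ℕ) : ℝ)) * (i.Mh : ℝ) = ((ℓ : ℝ) + 1) * ((i.Mh : ℕ) : ℝ); push_cast; ring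
  have hMS : M₀S ≤ ((ℓ : ℝ) + 1) * (toKT i).Mh := ((le_max_left _ _).trans (le_max_left _ _)).trans hM
  have hMC : M₀C ≤ ((ℓ : ℝ) + 1) * (toKT i).Mh := (((le_max_left _ _).trans (le_max_right _ _)).trans (le_max_left _ _)).trans hM
  have hMB : M₀B ≤ ((ℓ : ℝ) + 1) * (toKT i).Mh := (((le_max_right _ _).trans (le_max_right _ _)).trans (le_max_left _ _)).trans hM
  have hML₁ : ML₁ ≤ (geo9K i).M := by rw [hMg]; exact ((le_max_left _ _).trans (le_max_right _ _)).trans hM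
  have hML₂ : ML₂ ≤ (geo9K i).M := by rw [hMg]; exact (((le_max_left _ _).trans (le_max_right _ _)).trans (le_max_right _ _)).trans hM
  have hMT : 1024 * Real.log ((ℓ : ℝ) + 1) / (m * (2 * ((ℓ : ℝ) + 1) ^ 2 - 1)) ≤ (geo9K i).M := by
    rw [hMg]; exact (((le_max_right _ _).trans (le_max_right _ _)).trans (le_max_right _ _)).trans hM
  have hMT' : 1024 * Real.log ((ℓ : ℝ) + 1) ≤ m * (2 * ((ℓ : ℝ) + 1) ^ 2 - 1) * (geo9K i).M := by
    rw [div_le_iff₀ (by positivity)] at hMT; linarith only [hMT]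
  have hTS : T₀S ≤ RM1 i := ((le_max_left _ _).trans (le_max_left _ _)).trans hT
  have hTC : T₀C ≤ RM1 i := (((le_max_left _ _).trans (le_max_right _ _)).trans (le_max_left _ _)).trans hT
  have hTB : T₀B ≤ RM1 i := (((le_max_right _ _).trans (le_max_right _ _)).trans (le_max_left _ _)).trans hT
  have hTK : 4 * Real.log ((ℓ : ℝ) + 1) / (9 / 5000 * (m / 2)) ≤ RM1 i := (le_max_right _ _).trans hT
  have hNS : N₀S + 1 ≤ (toKT i).R * ((ℓ + 1) * (toKT i).Mh) := le_trans (Nat.succ_le_succ ((le_max_left _ _).trans (le_max_left _ _))) hN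
  have hNC : N₀C + 1 ≤ (toKT i).R * ((ℓ + 1) * (toKT i).Mh) :=
    le_trans (Nat.succ_le_succ (((le_max_left _ _).trans (le_max_right _ _)).trans (le_max_left _ _))) hN
  have hNB : N₀B + 1 ≤ (toKT i).R * ((ℓ + 1) * (toKT i).Mh) :=
    le_trans (Nat.succ_le_succ (((le_max_right _ _).trans (le_max_right _ _)).trans (le_max_left _ _))) hN
  have hN₁ : N1 d ℓ (9 / 5000 * δS) + 1 ≤ (toKT i).R * ((ℓ + 1) * (toKT i).Mh) :=
    le_trans (Nat.succ_le_succ ((le_max_left _ _).trans (le_max_right _ _))) hN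
  have hN₂ : N1 d ℓ (9 / 5000 * δC) + 1 ≤ (toKT i).R * ((ℓ + 1) * (toKT i).Mh) :=
    le_trans (Nat.succ_le_succ (((le_max_left _ _).trans (le_max_right _ _)).trans (le_max_right _ _))) hN
  have hN₃ : N1 d ℓ (9 / 5000 * δB) + 1 ≤ (toKT i).R * ((ℓ + 1) * (toKT i).Mh) :=
    le_trans (Nat.succ_le_succ (((le_max_right _ _).trans (le_max_right _ _)).trans (le_max_right _ _))) hN
  have ha₁S : ∀ c, max (C c) (C c * (1 + D1 thetaProf)) * Λ c ^ 2 ≤ a₁S := fun c => (hs₁ c).trans (min_le_left _ _)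
  have ha₁C : ∀ c, max (C c) (C c * (1 + D1 thetaProf)) * Λ c ^ 2 ≤ a₁C := fun c => (hs₁ c).trans ((min_le_right _ _).trans (min_le_left _ _))
  have ha₁B : ∀ c, max (C c) (C c * (1 + D1 thetaProf)) * Λ c ^ 2 ≤ a₁B := fun c => (hs₁ c).trans ((min_le_right _ _).trans (min_le_right _ _))
  have hMh8 : (8 : ℝ) ≤ (i.Mh : ℝ) := by exact_mod_cast i.hM8
  -- ─── units ───
  have hetaS : etaS i = (kGeo i).eta := B9Cor36GpCoverBindersUnitary.etaS_eq_kGeo_eta_of_cf i hcf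
  have hη : etaS i = |i.cf|⁻¹ := by have h := hetaS; exact h
  have hη0 : 0 < etaS i := B9Ineq349SiteComposite.etaS_pos i
  have hs : (etaS i ^ 2 * etaS i ^ 2) * (etaS i ^ 2 * etaS i ^ 2)⁻¹ = 1 := mul_inv_cancel₀ (by positivity)
  have hs4 : ((kGeo i).eta ^ 4)⁻¹ = (etaS i ^ 2 * etaS i ^ 2)⁻¹ := by rw [hetaS]; ring
  -- ─── the member geometry ───
  obtain ⟨h261_11, h261_12G, h261_12m⟩ := hgeo₁ i hML₁
  obtain ⟨h261_21, h261_22O, h261_22t⟩ := hgeo₂ i hML₂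
  have hl0 : ∀ a : (geo9K i).Site, 0 ≤ (geo9K i).len a := fun a => (geo9K_len_pos i a).le
  have hLpow : ∀ ⦃p q : ℕ⦄, p ≤ q → ((ℓ : ℝ) + 1) ^ p ≤ ((ℓ : ℝ) + 1) ^ q := fun p q h => pow_le_pow_right₀ hL1 h
  have hthr : ∀ ⦃c a : ℝ⦄, 0 ≤ c → c ≤ 4 → 1 / 256 * m ≤ a → c * Real.log ((ℓ : ℝ) + 1) ≤ a * (2 * ((ℓ : ℝ) + 1) ^ 2 - 1) * (geo9K i).M := by
    intro c a hc0 hc4 ha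
    have hM0 : 0 ≤ (geo9K i).M := by rw [hMg]; positivity
    have h1 : c * Real.log ((ℓ : ℝ) + 1) ≤ 4 * Real.log ((ℓ : ℝ) + 1) := mul_le_mul_of_nonneg_right hc4 hlog
    have h2 : 1 / 256 * m * ((2 * ((ℓ : ℝ) + 1) ^ 2 - 1) * (geo9K i).M) ≤ a * ((2 * ((ℓ : ℝ) + 1) ^ 2 - 1) * (geo9K i).M) :=
      mul_le_mul_of_nonneg_right ha (by positivity)
    have h3 : 1 / 256 * m * ((2 * ((ℓ : ℝ) + 1) ^ 2 - 1) * (geo9K i).M) = 1 / 256 * (m * (2 * ((ℓ : ℝ) + 1) ^ 2 - 1) * (geo9K i).M) := by ring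
    have h4 : a * ((2 * ((ℓ : ℝ) + 1) ^ 2 - 1) * (geo9K i).M) = a * (2 * ((ℓ : ℝ) + 1) ^ 2 - 1) * (geo9K i).M := by ring
    linarith only [h1, h2, h3, h4, hMT']
  -- main group `(m∕8, 1∕8)`: `ℓ`, `ℓ⁻⁴` with constant `L⁴`
  have hT1 : ScaleTransfer (geo9K i) (1 / 8 * m) (1 / 8) (((ℓ : ℝ) + 1) ^ 4) (fun a => (geo9K i).len a) :=
    scaleTransfer_mono_const hl0 ((pow_one _).symm.le.trans (hLpow (by norm_num))) (scaleTransfer_len_geo9K i hp₁ (by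
      have := hthr (c := 1) (a := 1 / 8 * (1 / 8 * m)) (by norm_num) (by norm_num) (by linarith only [hm.le]); linarith only [this]))
  have hT4 : ScaleTransfer (geo9K i) (1 / 8 * m) (1 / 8) (((ℓ : ℝ) + 1) ^ 4) (fun a => ((geo9K i).len a ^ 4)⁻¹) :=
    scaleTransfer_len_inv4_geo9K i hp₁ (hthr (by norm_num) (by norm_num) (by linarith only [hm.le]))
  -- E3 group `(m, 1∕8)` and `(m, 1∕4)`: `ℓ` with constant `L`
  have hT13 : ScaleTransfer (geo9K i) m (1 / 8) ((ℓ : ℝ) + 1) (fun a => (geo9K i).len a) :=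
    scaleTransfer_len_geo9K i (by positivity) (by
      have := hthr (c := 1) (a := 1 / 8 * m) (by norm_num) (by norm_num) (by linarith only [hm.le]); linarith only [this])
  have hTst : ScaleTransfer (geo9K i) m (1 / 4) ((ℓ : ℝ) + 1) (fun a => (geo9K i).len a) :=
    scaleTransfer_len_geo9K i (by positivity) (by
      have := hthr (c := 1) (a := 1 / 4 * m) (by norm_num) (by norm_num) (by linarith only [hm.le]); linarith only [this])
  -- w group `(m, 1∕256)`: `ℓ⁻⁴`, `ℓ²`, `ℓ⁻³`, `ℓ⁻¹`, `ℓ`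
  have hST4w : ScaleTransfer (geo9K i) m (1 / 256) (((ℓ : ℝ) + 1) ^ 4) (fun a => ((geo9K i).len a ^ 4)⁻¹) :=
    scaleTransfer_len_inv4_geo9K i hp₄ (hthr (by norm_num) (by norm_num) le_rfl)
  have hST2w : ScaleTransfer (geo9K i) m (1 / 256) (((ℓ : ℝ) + 1) ^ 2) (fun a => (geo9K i).len a ^ 2) :=
    scaleTransfer_len_sq_geo9K i hp₄ (hthr (by norm_num) (by norm_num) le_rfl)
  have hST3w : ScaleTransfer (geo9K i) m (1 / 256) (((ℓ : ℝ) + 1) ^ 3) (fun a => ((geo9K i).len a ^ 3)⁻¹) :=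
    scaleTransfer_len_inv_pow_geo9K i 3 hp₄ (by
      have := hthr (c := 3) (a := 1 / 256 * m) (by norm_num) (by norm_num) le_rfl; norm_num; linarith only [this])
  have hSTm1w : ScaleTransfer (geo9K i) m (1 / 256) ((ℓ : ℝ) + 1) (fun a => ((geo9K i).len a)⁻¹) := by
    have h := scaleTransfer_len_inv_pow_geo9K i 1 hp₄ (by
      have := hthr (c := 1) (a := 1 / 256 * m) (by norm_num) (by norm_num) le_rfl; norm_num; linarith only [this])
    simpa only [pow_one] using h
  have hST1w : ScaleTransfer (geo9K i) m (1 / 256) ((ℓ : ℝ) + 1) (fun a => (geo9K i).len a) :=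
    scaleTransfer_len_geo9K i hp₄ (by have := hthr (c := 1) (a := 1 / 256 * m) (by norm_num) (by norm_num) le_rfl; linarith only [this])
  -- tails group `(m, 1∕32)`: `ℓ`, `ℓ⁻⁴`, `ℓ⁻³`, `ℓ²`
  have hST1t : ScaleTransfer (geo9K i) m (1 / 32) ((ℓ : ℝ) + 1) (fun a => (geo9K i).len a) :=
    scaleTransfer_len_geo9K i hp₆ (by
      have := hthr (c := 1) (a := 1 / 32 * m) (by norm_num) (by norm_num) (by linarith only [hm.le]); linarith only [this])
  have hST4t : ScaleTransfer (geo9K i) m (1 / 32) (((ℓ : ℝ) + 1) ^ 4) (fun a => ((geo9K i).len a ^ 4)⁻¹) :=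
    scaleTransfer_len_inv4_geo9K i hp₆ (hthr (by norm_num) (by norm_num) (by linarith only [hm.le]))
  have hST3t : ScaleTransfer (geo9K i) m (1 / 32) (((ℓ : ℝ) + 1) ^ 3) (fun a => ((geo9K i).len a ^ 3)⁻¹) :=
    scaleTransfer_len_inv_pow_geo9K i 3 hp₆ (by
      have := hthr (c := 3) (a := 1 / 32 * m) (by norm_num) (by norm_num) (by linarith only [hm.le]); norm_num; linarith only [this])
  have hST2t : ScaleTransfer (geo9K i) m (1 / 32) (((ℓ : ℝ) + 1) ^ 2) (fun a => (geo9K i).len a ^ 2) :=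
    scaleTransfer_len_sq_geo9K i hp₆ (hthr (by norm_num) (by norm_num) (by linarith only [hm.le]))
  -- last group `(δ_O, r′∕2)`: `ℓ²`
  have hSTO : ScaleTransfer (geo9K i) δO (r' / 2) (((ℓ : ℝ) + 1) ^ 2) (fun a => (geo9K i).len a ^ 2) := by
    have hε : 0 < r' / 2 * δO := by positivity
    have hval : r' / 2 * δO = 1 / 32 * m := by rw [hr'def]; field_simp; ring
    refine scaleTransfer_len_sq_geo9K i hε ?_
    rw [hval]; exact hthr (by norm_num) (by norm_num) (by linarith only [hm.le])
  -- ─── the cube-side data at this member ───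
  have HSc := fun c : ↥(cubes (toKT i).D.toDomains) => HS i c (Rr i) (Hp i) hMS hNS hTS (u c) (cfg U₁) (A c) (Q c) (C c) (ξ c) (Λ c)
    (hC0 c) (hξ c) (hΛ c) (hξS c) (hΛξ c) (hQ c) (hgA c) (hAb c) (hdA c) (ha₁S c) (hs₄ c)
  have HCc := fun c : ↥(cubes (toKT i).D.toDomains) => HC i c (Rr i) (Hp i) hMC hNC hTC (A c) (Q c) (C c) (ξ c) (Λ c)
    (hC0 c) (hξ c) (hΛ c) (hξS c) (hΛξ c) (hQ c) (hAb c) (hdA c) (ha₁C c) (hs₄ c)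
  have HBc := fun c : ↥(cubes (toKT i).D.toDomains) => HB i c (Rr i) (Hp i) hMB hNB hTB (u c) (cfg U₁) (A c) (Q c) (C c) (ξ c) (Λ c)
    (hC0 c) (hξ c) (hΛ c) (hξS c) (hΛξ c) (hQ c) (hgA c) (hAb c) (hdA c) (ha₁B c) (hs₄ c)
  have h261Sc : ∀ c : ↥(cubes (toKT i).D.toDomains), Ineq261 dBS (toB6 (geoCK i c) (Rr i) (Hp i)) δS (1 / 2) :=
    fun c => h261S i c (Rr i) (Hp i) hN₁ _ (by norm_num) (by norm_num)
  have h261Cc' : ∀ c : ↥(cubes (toKT i).D.toDomains), Ineq261 dBCc (toB6 (geoCK i c) (Rr i) (Hp i)) δC (1 / 2) :=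
    fun c => h261Cc i c (Rr i) (Hp i) hN₂ _ (by norm_num) (by norm_num)
  have h261Bc' : ∀ c : ↥(cubes (toKT i).D.toDomains), Ineq261 dBBc (toB6 (geoCK i c) (Rr i) (Hp i)) δB (1 / 2) :=
    fun c => h261Bc i c (Rr i) (Hp i) hN₃ _ (by norm_num) (by norm_num)
  have hSTcK : ∀ c : ↥(cubes (toKT i).D.toDomains),
      ScaleTransfer (geoCK i c) (m / 2) (1 / 2) (((ℓ : ℝ) + 1) ^ 4) (fun a => ((geoCK i c).len a ^ 4)⁻¹) :=
    fun c => (hST_geoCK i c (half_pos hm) hTK (1 / 2) (by norm_num)).2.2.2.2.1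
  -- units and letters per cube
  have hV : ∀ c : ↥(cubes (toKT i).D.toDomains),
      IsUnit (deltaPrimeACubeY i c (parSymY i) (gaugeY i (u c)⁻¹ (locCfgY i c (kGeo i).eta (A c)))) :=
    fun c => isUnit_deltaPrimeACubeY_gauge_inv i c (parSymY_isGaugeLawS i) (u c) (HSc c).1
  have hXc : ∀ c : ↥(cubes (toKT i).D.toDomains),
      IsUnit (XCubeY i c (parSymY i) (gaugeY i (u c)⁻¹ (locCfgY i c (kGeo i).eta (A c)))) :=
    fun c => isUnit_XCubeY_gauge i c (u c)⁻¹ (HCc c).1.1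
  have hR := fun c : ↥(cubes (toKT i).D.toDomains) => (HSc c).2.1
  have hTc := fun c : ↥(cubes (toKT i).D.toDomains) => (HSc c).2.2
  -- the cube resolvent `sS_□(Ṽ_□)` at the rate `δ_C`, constant `B_S`, and weakened to the rate `m∕2`
  have hκQ : ∀ c : ↥(cubes (toKT i).D.toDomains), 0 ≤ (M₂ * ∑ j, ‖b j‖) * (1 + Cq d * (max (C c) (C c * (1 + D1 thetaProf)) * Λ c ^ 2)) :=
    fun c => mul_nonneg hS (add_nonneg zero_le_one (mul_nonneg hCq (mul_nonneg (le_max_of_le_left (hC0 c)) (sq_nonneg _))))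
  have hdnnC := fun c : ↥(cubes (toKT i).D.toDomains) => (geoCK_dist_axioms i c (Rr i) (Hp i)).1
  have hScC : ∀ c : ↥(cubes (toKT i).D.toDomains), HasMajorant (g := toB6 (geoCK i c) (Rr i) (Hp i)) (fun p : SiteY i × ι => blkCubeY i c p.1)
      (conj b ((((((etaS i ^ 2 * etaS i ^ 2)⁻¹ : ℝ) : ℂ)) • (QpsCubeY i c (parSymY i) (locCfgY i c (kGeo i).eta (A c)) ∘ₗ
        XinvCubeY i c (parSymY i) (locCfgY i c (kGeo i).eta (A c)) ∘ₗ QpCubeY i c (parSymY i) (locCfgY i c (kGeo i).eta (A c)))).restrictScalars ℝ))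
      (fun a s => BS * ((geoCK i c).len a ^ 4)⁻¹ * Real.exp (-(δC * (geoCK i c).dist a s))) := by
    intro c
    obtain ⟨⟨-, hCi⟩, hQh, hQsh⟩ := HCc c
    rw [hs4] at hCi
    have h := hasMajorant_resolventCube_of_cinv i c b (locCfgY i c (kGeo i).eta (A c)) ((etaS i ^ 2 * etaS i ^ 2)⁻¹) (hκQ c) hBC.le hQh hQsh hCi
    refine hasMajorant_mono (g := toB6 (geoCK i c) (Rr i) (Hp i)) _ h fun a s => ?_
    have hq1 : (M₂ * ∑ j, ‖b j‖) * (1 + Cq d * (max (C c) (C c * (1 + D1 thetaProf)) * Λ c ^ 2)) ≤ (M₂ * ∑ j, ‖b j‖) * (1 + Cq d * (1 / 4)) :=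
      mul_le_mul_of_nonneg_left (by have := mul_le_mul_of_nonneg_left (hs₄ c) hCq; linarith only [this]) hS
    have hsq : ((M₂ * ∑ j, ‖b j‖) * (1 + Cq d * (max (C c) (C c * (1 + D1 thetaProf)) * Λ c ^ 2))) ^ 2 ≤ ((M₂ * ∑ j, ‖b j‖) * (1 + Cq d * (1 / 4))) ^ 2 :=
      pow_le_pow_left₀ (hκQ c) hq1 2
    have hk : ((M₂ * ∑ j, ‖b j‖) * (1 + Cq d * (max (C c) (C c * (1 + D1 thetaProf)) * Λ c ^ 2))) ^ 2 * BC ≤ BS := by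
      rw [hBSdef]; exact mul_le_mul_of_nonneg_right hsq hBC.le
    exact mul_le_mul_of_nonneg_right (mul_le_mul_of_nonneg_right hk (inv_nonneg.2 (pow_nonneg (B9CubeGeometryInputs.geoCK_len_pos i c a).le 4)))
      (Real.exp_nonneg _)
  have hScK : ∀ c : ↥(cubes (toKT i).D.toDomains), HasMajorant (g := toB6 (geoCK i c) (Rr i) (Hp i)) (fun p : SiteY i × ι => blkCubeY i c p.1)
      (conj b ((((((etaS i ^ 2 * etaS i ^ 2)⁻¹ : ℝ) : ℂ)) • (QpsCubeY i c (parSymY i) (locCfgY i c (kGeo i).eta (A c)) ∘ₗ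
        XinvCubeY i c (parSymY i) (locCfgY i c (kGeo i).eta (A c)) ∘ₗ QpCubeY i c (parSymY i) (locCfgY i c (kGeo i).eta (A c)))).restrictScalars ℝ))
      (fun a s => BS * ((geoCK i c).len a ^ 4)⁻¹ * Real.exp (-(m / 2 * (geoCK i c).dist a s))) :=
    fun c => hasMajorant_mono (g := toB6 (geoCK i c) (Rr i) (Hp i)) _ (hScC c) fun a s =>
      kernel_rate_mono (hdnnC c) (by linarith only [hmC, hm.le]) (mul_nonneg hBS (inv_nonneg.2 (pow_nonneg (B9CubeGeometryInputs.geoCK_len_pos i c a).le 4))) a s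
  -- the cube `η²G′_□(Ṽ_□)` block
  have hBc : ∀ c : ↥(cubes (toKT i).D.toDomains), HasMajorant (g := toB6 (geoCK i c) (Rr i) (Hp i)) (fun p : SiteY i × ι => blkCubeY i c p.1)
      (conj b ((((((etaS i ^ 2 : ℝ)) : ℂ)) • GpCubeY i c (parSymY i) (locCfgY i c (kGeo i).eta (A c))).restrictScalars ℝ))
      (fun a s => Bf * (geoCK i c).len a ^ 2 * Real.exp (-(δB * (geoCK i c).dist a s))) := by
    intro c
    have h := (HBc c).2.1
    have e2 : ((((kGeo i).eta ^ 2 : ℝ)) : ℂ) = ((((etaS i ^ 2 : ℝ)) : ℂ)) := by rw [hetaS]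
    rw [GpVK_eq_conj_smul, e2] at h
    exact h
  -- E3f's adjoint cube letter weakened to the rate `m∕2`, and transferred to the member at the rate `3m∕8`
  have hTcK : ∀ c : ↥(cubes (toKT i).D.toDomains), HasMajorant (g := toB6 (geoCK i c) (Rr i) (Hp i)) (fun p : SiteY i × ι => blkCubeY i c p.1)
      (conj b ((GpCubeY i c (parSymY i) (locCfgY i c (kGeo i).eta (A c)) *
        (deltaPrimeACubeY i c (parSymY i) (locCfgY i c (kGeo i).eta (A c)) * cutMulY (𝔸 := 𝔸) (chiY i c) -
          cutMulY (𝔸 := 𝔸) (chiY i c) * deltaPrimeACubeY i c (parSymY i) (locCfgY i c (kGeo i).eta (A c)))).restrictScalars ℝ))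
      (fun a s => θS * Real.exp (-(m / 2 * (geoCK i c).dist a s))) :=
    fun c => hasMajorant_mono (g := toB6 (geoCK i c) (Rr i) (Hp i)) _ (hTc c) fun a s =>
      kernel_rate_mono (hdnnC c) (by linarith only [hmS, hm.le]) hθS a s
  have hGK : ∀ c : ↥(cubes (toKT i).D.toDomains), HasMajorant (g := toB6 (geo9K i) (Rr i) (Hp i)) (fun p : SiteY i × ι => ιB (blkOf i.D.toDomains p.1))
      (conj b ((GpCubeY i c (parSymY i) (gaugeY i (u c)⁻¹ (locCfgY i c (kGeo i).eta (A c))) *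
        (deltaPrimeACubeY i c (parSymY i) (gaugeY i (u c)⁻¹ (locCfgY i c (kGeo i).eta (A c))) * cutMulY (𝔸 := 𝔸) (chiY i c) -
          cutMulY (𝔸 := 𝔸) (chiY i c) * deltaPrimeACubeY i c (parSymY i) (gaugeY i (u c)⁻¹ (locCfgY i c (kGeo i).eta (A c))))).restrictScalars ℝ))
      (fun a y'' => ((M₂ * ∑ j, ‖b j‖) ^ 2 * (θS * B6.c1 dBS δS (1 / 2))) * Real.exp (-(3 / 8 * m * (geo9K i).dist a y''))) :=
    fun c => hasMajorant_conj_commStepAdj_member_rate i c b hM₂ hrepr (parSymY_isGaugeLawS i) (u c) (hu c) (locCfgY i c (kGeo i).eta (A c)) ιB hι dBS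
      hθS hδS.le (by norm_num) (by linarith only [hmS, hm.le] : 3 / 8 * m ≤ (1 - 1 / 2) * δS) (h261Sc c) (hTc c)
  -- ─── the located tails (FILES 8a∕8b∕8c), each restated with the named constants ───
  have hRop : ∀ (c : ↥(cubes (toKT i).D.toDomains)) (ν : Fin (d + 1)), HasMajorant (g := toB6 (geo9K i) (Rr i) (Hp i))
      (fun p : SiteY i × ι => ιB (blkOf i.D.toDomains p.1))
      (conj b (((((etaS i ^ 2 : ℝ) : ℂ)) • GpCubeY i c (parSymY i) (gaugeY i (u c)⁻¹ (locCfgY i c (kGeo i).eta (A c)))).restrictScalars ℝ) *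
        mulOp (fun p : SiteY i × ι => bumpY i (ctrR i c) (3 * (SC i c : ℝ)) p.1) * conj b (diffLetter (shiftY i) (UboxY i (cfg U₁)) (((etaS i : ℝ) : ℂ))⁻¹ (Sum.inr ν)))
      (fun a a' => κR * (geo9K i).len a * Real.exp (-(1 / 8 * m * (geo9K i).dist a a'))) := by
    intro c ν
    have h := hasMajorant_rightEntry_at i c b cfg hE hBG ιB hι hM₂ hrepr hη ν (u c) (kGeo i).eta (A c) (hQ c) (hgA c) hU (hV c) e22
      hm.le (by linarith only [hmG] : 1 * m ≤ δG) (by norm_num : (0 : ℝ) ≤ 1 / 32) hL0.le hST1t hθK (by norm_num : (0 : ℝ) ≤ 1 / 8)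
      (by norm_num : (1 : ℝ) / 8 ≤ 1 - 1 / 32) (by norm_num : (1 : ℝ) / 8 + (1 / 32 + 1 / 32) ≤ 3 / 8) h261_22t (hGK c)
    refine hasMajorant_mono (g := toB6 (geo9K i) (Rr i) (Hp i)) _ h fun a a' => ?_
    rw [hκRdef]
  have hLw : ∀ (c : ↥(cubes (toKT i).D.toDomains)) (μ : Fin (d + 1)), HasMajorant (g := toB6 (geo9K i) (Rr i) (Hp i))
      (fun p : SiteY i × ι => ιB (blkOf i.D.toDomains p.1))
      (conj b (diffLetter (shiftY i) (UboxY i (cfg U₁)) (((etaS i : ℝ) : ℂ))⁻¹ (Sum.inl μ)) * mulOp (fun p : SiteY i × ι => bumpY i (ctrR i c) (3 * (SC i c : ℝ)) p.1) *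
        conj b (((((etaS i ^ 2 : ℝ) : ℂ)) • GpCubeY i c (parSymY i) (gaugeY i (u c)⁻¹ (locCfgY i c (kGeo i).eta (A c)))).restrictScalars ℝ))
      (fun a a' : (geo9K i).Site => (if a ∈ (Finset.univ.filter fun a : (geo9K i).Site => ∃ z : SiteY i, ιB (blkOf i.D.toDomains z) = a ∧ NearC i c (21 * SC i c / 8 + 1) z.1)
        then (1 : ℝ) else 0) * (κL * (geo9K i).len a * Real.exp (-(1 / 8 * m * (geo9K i).dist a a')))) := by
    intro c μ
    have h := hasMajorant_leftEntry_at i c b cfg hE hBG ιB hι hM₂ hrepr μ (u c) (hu c) (kGeo i).eta (A c) (hQ c) (hgA c) hU (hV c) dBS hθS hδS.le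
      (by norm_num : (1 : ℝ) / 2 ≤ 1) (h261Sc c) (hR c) e22 hm.le (by norm_num : (0 : ℝ) ≤ 1 / 8) (by positivity : (0 : ℝ) ≤ 1 / 32 * m)
      (by positivity : (0 : ℝ) ≤ 1 / 32 * m) (by linarith only [hmG, hm.le] : 1 / 8 * m + (1 / 32 + 1 / 32) * m ≤ δG)
      (by linarith only [hmS, hm.le] : 1 / 8 * m ≤ (1 - 1 / 2) * δS) h261_22t
    refine hasMajorant_mono (g := toB6 (geo9K i) (Rr i) (Hp i)) _ h fun a a' => ?_
    have hSC : (0 : ℝ) < (SC i c : ℝ) := by exact_mod_cast lt_of_lt_of_le one_pos (one_le_SC i c)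
    have hcancel : |(etaS i)⁻¹| * (D1 thetaProf / (3 * (SC i c : ℝ))) * ((SC i c : ℝ) * (kGeo i).eta) = D1 thetaProf / 3 := by
      rw [abs_of_pos (inv_pos.2 hη0), ← hetaS]; field_simp
    have hκ : (M₂ * (∑ j, ‖b j‖) * BG + |(etaS i)⁻¹| * (D1 thetaProf / (3 * (SC i c : ℝ))) * ((SC i c : ℝ) * (kGeo i).eta) * (M₂ * (∑ j, ‖b j‖) * BG)) *
        (1 + (M₂ * ∑ j, ‖b j‖) ^ 2 * (θS * B6.c1 dBS δS (1 / 2)) * B6.c1 e22 m (1 / 32)) = κL := by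
      rw [hcancel, hκLdef]; ring
    rw [← hκ]
  have hTail0 : ∀ (c : ↥(cubes (toKT i).D.toDomains)) (ν : Fin (d + 1)), HasMajorant (g := toB6 (geo9K i) (Rr i) (Hp i))
      (fun p : SiteY i × ι => ιB (blkOf i.D.toDomains p.1))
      (conj b ((((((etaS i ^ 2 * etaS i ^ 2)⁻¹ : ℝ) : ℂ)) • (QpsCubeY i c (parSymY i) (gaugeY i (u c)⁻¹ (locCfgY i c (kGeo i).eta (A c))) ∘ₗ
          XinvCubeY i c (parSymY i) (gaugeY i (u c)⁻¹ (locCfgY i c (kGeo i).eta (A c))) ∘ₗ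
            QpCubeY i c (parSymY i) (gaugeY i (u c)⁻¹ (locCfgY i c (kGeo i).eta (A c))))).restrictScalars ℝ) *
        mulOp (fun p : SiteY i × ι => if NearC i c (3 * SC i c) p.1.1 then (1 : ℝ) else 0) *
        (conj b (((((etaS i ^ 2 : ℝ) : ℂ)) • GpCubeY i c (parSymY i) (gaugeY i (u c)⁻¹ (locCfgY i c (kGeo i).eta (A c)))).restrictScalars ℝ) *
          mulOp (fun p : SiteY i × ι => bumpY i (ctrR i c) (3 * (SC i c : ℝ)) p.1) * conj b (diffLetter (shiftY i) (UboxY i (cfg U₁)) (((etaS i : ℝ) : ℂ))⁻¹ (Sum.inr ν))))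
      (fun a a' => κT0 * ((geo9K i).len a ^ 3)⁻¹ * Real.exp (-(1 / 8 * m * (geo9K i).dist a a'))) := by
    intro c ν
    have h := hasMajorant_tail0_at i c b hM₂ hrepr (u c) (hu c) (locCfgY i c (kGeo i).eta (A c)) ιB hι ((((etaS i ^ 2 * etaS i ^ 2)⁻¹ : ℝ) : ℂ))
      hBS (by positivity : (0 : ℝ) ≤ ((ℓ : ℝ) + 1) ^ 4) (by linarith only [hm.le] : (0 : ℝ) ≤ m / 2 - 1 / 2 * (m / 2)) (hSTcK c) (hScK c) e22
      (by positivity : (0 : ℝ) ≤ ((ℓ : ℝ) + 1) ^ 4) hκR hL0.le (by positivity : (0 : ℝ) ≤ 1 / 8 * m)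
      (by linarith only [hm.le] : 1 / 8 * m + (1 / 32 + 1 / 32) * m ≤ m / 2 - 1 / 2 * (m / 2) - 1 / 32 * m) hST4t hST1t h261_22t (hRop c ν)
    refine hasMajorant_mono (g := toB6 (geo9K i) (Rr i) (Hp i)) _ h fun a a' => ?_
    rw [hκT0def]
  have hTail1 : ∀ (c : ↥(cubes (toKT i).D.toDomains)) (ν : Fin (d + 1)), HasMajorant (g := toB6 (geo9K i) (Rr i) (Hp i))
      (fun p : SiteY i × ι => ιB (blkOf i.D.toDomains p.1))
      (conj b (((((etaS i ^ 2 : ℝ) : ℂ)) • GpCubeY i c (parSymY i) (gaugeY i (u c)⁻¹ (locCfgY i c (kGeo i).eta (A c)))).restrictScalars ℝ) *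
        (conj b ((((((etaS i ^ 2 * etaS i ^ 2)⁻¹ : ℝ) : ℂ)) • (QpsCubeY i c (parSymY i) (gaugeY i (u c)⁻¹ (locCfgY i c (kGeo i).eta (A c))) ∘ₗ
            XinvCubeY i c (parSymY i) (gaugeY i (u c)⁻¹ (locCfgY i c (kGeo i).eta (A c))) ∘ₗ
              QpCubeY i c (parSymY i) (gaugeY i (u c)⁻¹ (locCfgY i c (kGeo i).eta (A c))))).restrictScalars ℝ) *
          mulOp (fun p : SiteY i × ι => if NearC i c (3 * SC i c) p.1.1 then (1 : ℝ) else 0) *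
          (conj b (((((etaS i ^ 2 : ℝ) : ℂ)) • GpCubeY i c (parSymY i) (gaugeY i (u c)⁻¹ (locCfgY i c (kGeo i).eta (A c)))).restrictScalars ℝ) *
            mulOp (fun p : SiteY i × ι => bumpY i (ctrR i c) (3 * (SC i c : ℝ)) p.1) * conj b (diffLetter (shiftY i) (UboxY i (cfg U₁)) (((etaS i : ℝ) : ℂ))⁻¹ (Sum.inr ν)))))
      (fun a a' => κT1 * ((geo9K i).len a)⁻¹ * Real.exp (-(1 / 8 * m * (geo9K i).dist a a'))) := by
    intro c ν
    have h := hasMajorant_tail1_at i c b hM₂ hrepr (u c) (hu c) (locCfgY i c (kGeo i).eta (A c)) ιB hι ((((etaS i ^ 2 : ℝ)) : ℂ)) dBBc hBf hδB.le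
      (by norm_num : (1 : ℝ) / 2 ≤ 1) (h261Bc' c) (hBc c) e22 hκT0 (by positivity : (0 : ℝ) ≤ ((ℓ : ℝ) + 1) ^ 3) (by positivity : (0 : ℝ) ≤ 1 / 8 * m)
      (by linarith only [hmB, hm.le] : 1 / 8 * m + (1 / 32 + 1 / 32) * m ≤ (1 - 1 / 2) * δB) hST3t h261_22t (hTail0 c ν)
    refine hasMajorant_mono (g := toB6 (geo9K i) (Rr i) (Hp i)) _ h fun a a' => ?_
    rw [hκT1def]
  have hTail2 : ∀ (c : ↥(cubes (toKT i).D.toDomains)) (ν : Fin (d + 1)), HasMajorant (g := toB6 (geo9K i) (Rr i) (Hp i))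
      (fun p : SiteY i × ι => ιB (blkOf i.D.toDomains p.1))
      (conj b (((((etaS i ^ 2 : ℝ) : ℂ)) • GpCubeY i c (parSymY i) (gaugeY i (u c)⁻¹ (locCfgY i c (kGeo i).eta (A c)))).restrictScalars ℝ) *
        conj b (((((etaS i ^ 2 : ℝ) : ℂ)) • GpCubeY i c (parSymY i) (gaugeY i (u c)⁻¹ (locCfgY i c (kGeo i).eta (A c)))).restrictScalars ℝ) *
        (conj b ((((((etaS i ^ 2 * etaS i ^ 2)⁻¹ : ℝ) : ℂ)) • (QpsCubeY i c (parSymY i) (gaugeY i (u c)⁻¹ (locCfgY i c (kGeo i).eta (A c))) ∘ₗ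
            XinvCubeY i c (parSymY i) (gaugeY i (u c)⁻¹ (locCfgY i c (kGeo i).eta (A c))) ∘ₗ
              QpCubeY i c (parSymY i) (gaugeY i (u c)⁻¹ (locCfgY i c (kGeo i).eta (A c))))).restrictScalars ℝ) *
          mulOp (fun p : SiteY i × ι => if NearC i c (3 * SC i c) p.1.1 then (1 : ℝ) else 0) *
          (conj b (((((etaS i ^ 2 : ℝ) : ℂ)) • GpCubeY i c (parSymY i) (gaugeY i (u c)⁻¹ (locCfgY i c (kGeo i).eta (A c)))).restrictScalars ℝ) *
            mulOp (fun p : SiteY i × ι => bumpY i (ctrR i c) (3 * (SC i c : ℝ)) p.1) * conj b (diffLetter (shiftY i) (UboxY i (cfg U₁)) (((etaS i : ℝ) : ℂ))⁻¹ (Sum.inr ν)))))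
      (fun a a' => κT2 * (geo9K i).len a * Real.exp (-(1 / 8 * m * (geo9K i).dist a a'))) := by
    intro c ν
    have h := hasMajorant_tail2_at i c b hM₂ hrepr (u c) (hu c) (locCfgY i c (kGeo i).eta (A c)) ιB hι ((((etaS i ^ 2 : ℝ)) : ℂ)) dBBc hBf hδB.le
      (by norm_num : (1 : ℝ) / 2 ≤ 1) (h261Bc' c) (hBc c) e22 hκT0 (by positivity : (0 : ℝ) ≤ ((ℓ : ℝ) + 1) ^ 2) (by positivity : (0 : ℝ) ≤ ((ℓ : ℝ) + 1) ^ 3)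
      (by positivity : (0 : ℝ) ≤ 1 / 8 * m) (by positivity : (0 : ℝ) ≤ 1 / 4 * m) (by positivity : (0 : ℝ) ≤ (1 / 32 + 1 / 32) * m)
      (by linarith only [hm.le] : 1 / 8 * m + (1 / 32 + 1 / 32) * m ≤ 1 / 4 * m)
      (by linarith only [hmB, hm.le] : 1 / 4 * m + (1 / 32 + 1 / 32) * m ≤ (1 - 1 / 2) * δB) hST2t hST3t h261_22t (hTail0 c ν)
    refine hasMajorant_mono (g := toB6 (geo9K i) (Rr i) (Hp i)) _ h fun a a' => ?_
    rw [hκT2def]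
  have hSbL : ∀ c : ↥(cubes (toKT i).D.toDomains), HasMajorant (g := toB6 (geo9K i) (Rr i) (Hp i)) (fun p : SiteY i × ι => ιB (blkOf i.D.toDomains p.1))
      (mulOp (fun p : SiteY i × ι => if NearC i c (3 * SC i c) p.1.1 then (1 : ℝ) else 0) *
        conj b ((((((etaS i ^ 2 * etaS i ^ 2)⁻¹ : ℝ) : ℂ)) • (QpsCubeY i c (parSymY i) (gaugeY i (u c)⁻¹ (locCfgY i c (kGeo i).eta (A c))) ∘ₗ
          XinvCubeY i c (parSymY i) (gaugeY i (u c)⁻¹ (locCfgY i c (kGeo i).eta (A c))) ∘ₗ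
            QpCubeY i c (parSymY i) (gaugeY i (u c)⁻¹ (locCfgY i c (kGeo i).eta (A c))))).restrictScalars ℝ))
      (fun a a' => κSb * ((geo9K i).len a ^ 4)⁻¹ * Real.exp (-((1 - 1 / 2) * δC * (geo9K i).dist a a'))) := by
    intro c
    have h := hasMajorant_sbL_at (Rr' := Rr i) (Hp := Hp i) i c b hM₂ hrepr (u c) (hu c) (locCfgY i c (kGeo i).eta (A c)) ιB hι
      ((((etaS i ^ 2 * etaS i ^ 2)⁻¹ : ℝ) : ℂ)) dBCc hBS hδC.le (by norm_num : (1 : ℝ) / 2 ≤ 1) (h261Cc' c) (hScC c)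
    refine hasMajorant_mono (g := toB6 (geo9K i) (Rr i) (Hp i)) _ h fun a a' => ?_
    rw [hκSbdef]
  have hTK : ∀ c : ↥(cubes (toKT i).D.toDomains), HasMajorant (g := toB6 (geo9K i) (Rr i) (Hp i)) (fun p : SiteY i × ι => ιB (blkOf i.D.toDomains p.1))
      (conj b ((((((etaS i ^ 2 * etaS i ^ 2)⁻¹ : ℝ) : ℂ)) • (QpsCubeY i c (parSymY i) (gaugeY i (u c)⁻¹ (locCfgY i c (kGeo i).eta (A c))) ∘ₗ
          XinvCubeY i c (parSymY i) (gaugeY i (u c)⁻¹ (locCfgY i c (kGeo i).eta (A c))) ∘ₗ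
            QpCubeY i c (parSymY i) (gaugeY i (u c)⁻¹ (locCfgY i c (kGeo i).eta (A c))))).restrictScalars ℝ) *
        conj b (((GpCubeY i c (parSymY i) (gaugeY i (u c)⁻¹ (locCfgY i c (kGeo i).eta (A c))) *
          (deltaPrimeACubeY i c (parSymY i) (gaugeY i (u c)⁻¹ (locCfgY i c (kGeo i).eta (A c))) * cutMulY (𝔸 := 𝔸) (chiY i c) -
            cutMulY (𝔸 := 𝔸) (chiY i c) * deltaPrimeACubeY i c (parSymY i) (gaugeY i (u c)⁻¹ (locCfgY i c (kGeo i).eta (A c))))).restrictScalars ℝ :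
          Module.End ℝ (SiteY i → 𝔸))))
      (fun a a' => κK * ((geo9K i).len a ^ 4)⁻¹ * Real.exp (-((m / 2 - 1 / 2 * (m / 2) - 1 / 32 * m) * (geo9K i).dist a a'))) := by
    intro c
    have h := hasMajorant_tk_at (Rr' := Rr i) (Hp := Hp i) i c b hM₂ hrepr (u c) (hu c) (locCfgY i c (kGeo i).eta (A c)) ιB hι
      ((((etaS i ^ 2 * etaS i ^ 2)⁻¹ : ℝ) : ℂ)) dBCc hBS hθS (by positivity : (0 : ℝ) ≤ m / 2)
      (by linarith only [hmC] : m / 2 + (0 + 1 / 2) * δC ≤ δC) (h261Cc' c) (by positivity : (0 : ℝ) ≤ ((ℓ : ℝ) + 1) ^ 4)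
      (by linarith only [hm.le] : (0 : ℝ) ≤ m / 2 - 1 / 2 * (m / 2)) (hSTcK c) (hScC c) (hTcK c) hST4t
    refine hasMajorant_mono (g := toB6 (geo9K i) (Rr i) (Hp i)) _ h fun a a' => ?_
    rw [hκKdef]
  have hGw : ∀ (c : ↥(cubes (toKT i).D.toDomains)) (ν : Fin (d + 1)), HasMajorant (g := toB6 (geo9K i) (Rr i) (Hp i))
      (fun p : SiteY i × ι => ιB (blkOf i.D.toDomains p.1))
      (conj b ((((((etaS i ^ 2 * etaS i ^ 2)⁻¹ : ℝ) : ℂ)) • (QpsCubeY i c (parSymY i) (gaugeY i (u c)⁻¹ (locCfgY i c (kGeo i).eta (A c))) ∘ₗ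
          XinvCubeY i c (parSymY i) (gaugeY i (u c)⁻¹ (locCfgY i c (kGeo i).eta (A c))) ∘ₗ
            QpCubeY i c (parSymY i) (gaugeY i (u c)⁻¹ (locCfgY i c (kGeo i).eta (A c))))).restrictScalars ℝ) *
        (conj b (((((etaS i ^ 2 : ℝ) : ℂ)) • GpCubeY i c (parSymY i) (gaugeY i (u c)⁻¹ (locCfgY i c (kGeo i).eta (A c)))).restrictScalars ℝ) *
          mulOp (fun p : SiteY i × ι => bumpY i (ctrR i c) (3 * (SC i c : ℝ)) p.1) * conj b (diffLetter (shiftY i) (UboxY i (cfg U₁)) (((etaS i : ℝ) : ℂ))⁻¹ (Sum.inr ν))))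
      (fun a a' => κG * ((geo9K i).len a ^ 3)⁻¹ * Real.exp (-(1 / 16 * m * (geo9K i).dist a a'))) := by
    intro c ν
    have h := hasMajorant_gw_at i c b cfg hE hBG ιB hι hM₂ hrepr hη ν (u c) (hu c) (kGeo i).eta (A c) (hQ c) (hgA c) hU (hV c)
      ((((etaS i ^ 2 * etaS i ^ 2)⁻¹ : ℝ) : ℂ)) hBS (by positivity : (0 : ℝ) ≤ ((ℓ : ℝ) + 1) ^ 4)
      (by linarith only [hm.le] : (0 : ℝ) ≤ m / 2 - 1 / 2 * (m / 2)) (hSTcK c) (hScK c) e22 hm.le (by linarith only [hmG] : 1 * m ≤ δG)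
      (by norm_num : (0 : ℝ) ≤ 1 / 32) hL0.le hST1t (by norm_num : (0 : ℝ) ≤ 1 / 16) (by norm_num : (1 : ℝ) / 16 ≤ 1 - 1 / 32) h261_22t
      (by positivity : (0 : ℝ) ≤ ((ℓ : ℝ) + 1) ^ 4) hST4t hκK
      (by linarith only [hm.le] : 1 / 16 * m + (1 / 32 + 1 / 32) * m ≤ m / 2 - 1 / 2 * (m / 2) - 1 / 32 * m) (hTK c)
    refine hasMajorant_mono (g := toB6 (geo9K i) (Rr i) (Hp i)) _ h fun a a' => ?_
    rw [hκGdef]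
  have hPb := fun c : ↥(cubes (toKT i).D.toDomains) =>
    hasMajorant_projCube_member (Rr' := Rr i) (Hp := Hp i) i c b (Rr i) (Hp i) hM₂ hrepr (gaugeY i (u c)⁻¹ (locCfgY i c (kGeo i).eta (A c))) (hparV c) ιB
  -- ─── the common collar factor ───
  obtain ⟨E, hEdef⟩ : ∃ x : ℝ, x = Real.exp (-(3 / 128 * m * (3 / 8 * (i.Mh : ℝ) - 3))) := ⟨_, rfl⟩
  have hE0 : 0 ≤ E := by rw [hEdef]; exact Real.exp_nonneg _
  have hE1 : E ≤ 1 := by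
    rw [hEdef]; refine Real.exp_le_one_iff.mpr ?_
    have h38 : 0 ≤ 3 / 8 * (i.Mh : ℝ) - 3 := by linarith only [hMh8]
    have := mul_nonneg (by positivity : (0 : ℝ) ≤ 3 / 128 * m) h38
    linarith only [this]
  have hEG1 : Real.exp (-(1 / 8 * δG * (3 / 8 * (i.Mh : ℝ) - 1))) ≤ E := by
    rw [hEdef]; exact exp_collar_le (by positivity) (by linarith only [hmG, hm.le]) (by norm_num) hMh8
  have hEG2 : Real.exp (-(1 / 8 * δG * (3 / 8 * (i.Mh : ℝ) - 2))) ≤ E := by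
    rw [hEdef]; exact exp_collar_le (by positivity) (by linarith only [hmG, hm.le]) (by norm_num) hMh8
  have hE31 : Real.exp (-(1 / 8 * m * (3 / 8 * (i.Mh : ℝ) - 1))) ≤ E := by
    rw [hEdef]; exact exp_collar_le (by positivity) (by linarith only [hm.le]) (by norm_num) hMh8
  have hE33 : Real.exp (-(1 / 8 * m * (3 / 8 * (i.Mh : ℝ) - 3))) ≤ E := by
    rw [hEdef]; exact exp_collar_le (by positivity) (by linarith only [hm.le]) (by norm_num) hMh8
  have hEw1 : Real.exp (-((3 / 128 * m) * (3 / 8 * (i.Mh : ℝ) - 1))) ≤ E := by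
    rw [hEdef]; exact exp_collar_le (by positivity) le_rfl (by norm_num) hMh8
  have hEw2 : Real.exp (-((3 / 128 * m) * (3 / 8 * (i.Mh : ℝ) - 2))) ≤ E := by
    rw [hEdef]; exact exp_collar_le (by positivity) le_rfl (by norm_num) hMh8
  -- the three budgets with the collar factors bounded by `E`
  obtain ⟨εR, hεRdef⟩ : ∃ x : ℝ, x = ((M₂ * ∑ j, ‖b j‖) * BG * (1 + ((ℓ : ℝ) + 1) * (D1 thetaProf / 3))) * (E + ((M₂ * ∑ j, ‖b j‖) ^ 2 * (θS * B6.c1 dBS δS (1 / 2))) * ((ℓ : ℝ) + 1) * B6.c1 e12 m (1 - 1 / 8 - 1 / 8 - 1 / 8) * E) := ⟨_, rfl⟩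
  obtain ⟨εT, hεTdef⟩ : ∃ x : ℝ, x = ((M₂ * ∑ j, ‖b j‖) * BG * (1 + D1 thetaProf / 3)) * (E + ((M₂ * ∑ j, ‖b j‖) ^ 2 * (θS * B6.c1 dBS δS (1 / 2))) * B6.c1 e12 δG (m / (4 * δG) - m / (8 * δG)) * E) + εR := ⟨_, rfl⟩
  obtain ⟨ε₃, hε₃def⟩ : ∃ x : ℝ, x = ((d : ℝ) + 1) * (κL * ((M₂ * ∑ j, ‖b j‖) ^ 2 * B₁) * (M₂ * ∑ j, ‖b j‖) ^ 2 * κT2 * (((ℓ : ℝ) + 1) ^ 4 * ((ℓ : ℝ) + 1)) * B6.c1 e21 m (1 / 256) ^ 2 * E + κL * ((M₂ * ∑ j, ‖b j‖) ^ 2 * B₁) * (M₂ * (∑ j, ‖b j‖) * BG) ^ 2 * (M₂ * ∑ j, ‖b j‖) ^ 2 * κT0 * (((ℓ : ℝ) + 1) ^ 4 * (((ℓ : ℝ) + 1) ^ 2) ^ 2 * ((ℓ : ℝ) + 1) ^ 3) * B6.c1 e21 m (1 / 256) ^ 4 * E + κL * ((M₂ * ∑ j, ‖b j‖) ^ 2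 * B₁) * (M₂ * (∑ j, ‖b j‖) * BG) ^ 2 * ((M₂ * ∑ j, ‖b j‖) ^ 2 * (θS * B6.c1 dBS δS (1 / 2))) * κT0 * (((ℓ : ℝ) + 1) ^ 4 * (((ℓ : ℝ) + 1) ^ 2) ^ 2 * ((ℓ : ℝ) + 1) ^ 3) * B6.c1 e21 m (1 / 256) ^ 5 * E + κL * ((M₂ * ∑ j, ‖b j‖) ^ 2 * B₁) * (M₂ * (∑ j, ‖b j‖) * BG) * ((M₂ * ∑ j, ‖b j‖) ^ 2 * (θS * B6.c1 dBS δS (1 / 2))) * κT1 * (((ℓ : ℝ) + 1) ^ 4 * ((ℓ : ℝ) + 1) ^ 2 * ((ℓ : ℝ) + 1)) * B6.c1 e21 m (1 / 256) ^ 4 * E + κL * ((M₂ * ∑ j, ‖b j‖) ^ 2 * B₁) * κR * (((ℓ : ℝ) + 1) ^ 4 * ((ℓ : ℝ) + 1)) * B6.c1 e21 m (1 / 256) ^ 2 * E + κL * κSb * κR * (((ℓ : ℝ) + 1) ^ 4 * ((ℓ : ℝ) + 1)) * B6.c1 e21 m (1 / 256) ^ 2 * E + κL * E * (((M₂ * ∑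 j, ‖b j‖) ^ 2 * B₁) * κR * ((ℓ : ℝ) + 1) * B6.c1 e21 m (1 / 256)) * ((ℓ : ℝ) + 1) ^ 3 * B6.c1 e21 m (1 / 256) + κL * E * κG * ((ℓ : ℝ) + 1) ^ 3 * B6.c1 e21 m (1 / 256)) := ⟨_, rfl⟩
  have hεR0 : 0 ≤ εR := by rw [hεRdef]; positivity
  have hεT0 : 0 ≤ εT := by rw [hεTdef]; positivity
  have hεDT : ((M₂ * ∑ j, ‖b j‖) * BG * (1 + D1 thetaProf / 3)) * (Real.exp (-(1 / 8 * δG * (3 / 8 * (i.Mh : ℝ) - 1))) + ((M₂ * ∑ j, ‖b j‖) ^ 2 * (θS * B6.c1 dBS δS (1 / 2))) * B6.c1 e12 δG (m / (4 * δG) - m / (8 * δG)) * Real.exp (-(1 / 8 * δG * (3 / 8 * (i.Mh : ℝ) - 2)))) ≤ εT := by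
    have h1 : ((M₂ * ∑ j, ‖b j‖) * BG * (1 + D1 thetaProf / 3)) * (Real.exp (-(1 / 8 * δG * (3 / 8 * (i.Mh : ℝ) - 1))) + ((M₂ * ∑ j, ‖b j‖) ^ 2 * (θS * B6.c1 dBS δS (1 / 2))) * B6.c1 e12 δG (m / (4 * δG) - m / (8 * δG)) * Real.exp (-(1 / 8 * δG * (3 / 8 * (i.Mh : ℝ) - 2)))) ≤ ((M₂ * ∑ j, ‖b j‖) * BG * (1 + D1 thetaProf / 3)) * (E + ((M₂ * ∑ j, ‖b j‖) ^ 2 * (θS * B6.c1 dBS δS (1 / 2))) * B6.c1 e12 δG (m / (4 * δG) - m / (8 * δG)) * E) := by gcongr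
    rw [hεTdef]; linarith only [h1, hεR0]
  have hεR3 : ((M₂ * ∑ j, ‖b j‖) * BG * (1 + ((ℓ : ℝ) + 1) * (D1 thetaProf / 3))) * (Real.exp (-(1 / 8 * m * (3 / 8 * (i.Mh : ℝ) - 1))) + ((M₂ * ∑ j, ‖b j‖) ^ 2 * (θS * B6.c1 dBS δS (1 / 2))) * ((ℓ : ℝ) + 1) * B6.c1 e12 m (1 - 1 / 8 - 1 / 8 - 1 / 8) * Real.exp (-(1 / 8 * m * (3 / 8 * (i.Mh : ℝ) - 3)))) ≤ εR := by
    rw [hεRdef]; gcongr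
  have hεRT : εR ≤ εT := by
    rw [hεTdef]
    have h0 : 0 ≤ ((M₂ * ∑ j, ‖b j‖) * BG * (1 + D1 thetaProf / 3)) * (E + ((M₂ * ∑ j, ‖b j‖) ^ 2 * (θS * B6.c1 dBS δS (1 / 2))) * B6.c1 e12 δG (m / (4 * δG) - m / (8 * δG)) * E) := by positivity
    linarith only [h0]
  have hε₃w : ((d : ℝ) + 1) * (κL * ((M₂ * ∑ j, ‖b j‖) ^ 2 * B₁) * (M₂ * ∑ j, ‖b j‖) ^ 2 * κT2 * (((ℓ : ℝ) + 1) ^ 4 * ((ℓ : ℝ) + 1)) * B6.c1 e21 m (1 / 256) ^ 2 * Real.exp (-((3 / 128 * m) * (3 / 8 * (i.Mh : ℝ) - 1))) + κL * ((M₂ * ∑ j, ‖b j‖) ^ 2 * B₁) * (M₂ * (∑ j, ‖b j‖) * BG) ^ 2 * (M₂ * ∑ j, ‖b j‖) ^ 2 * κT0 * (((ℓ : ℝ) + 1) ^ 4 * (((ℓ : ℝ) + 1) ^ 2) ^ 2 * ((ℓ : ℝ) + 1) ^ 3) * B6.c1 e21 m (1 / 256) ^ 4 * Real.exp (-((3 /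 128 * m) * (3 / 8 * (i.Mh : ℝ) - 1))) + κL * ((M₂ * ∑ j, ‖b j‖) ^ 2 * B₁) * (M₂ * (∑ j, ‖b j‖) * BG) ^ 2 * ((M₂ * ∑ j, ‖b j‖) ^ 2 * (θS * B6.c1 dBS δS (1 / 2))) * κT0 * (((ℓ : ℝ) + 1) ^ 4 * (((ℓ : ℝ) + 1) ^ 2) ^ 2 * ((ℓ : ℝ) + 1) ^ 3) * B6.c1 e21 m (1 / 256) ^ 5 * Real.exp (-((3 / 128 * m) * (3 / 8 * (i.Mh : ℝ) - 2))) + κL * ((M₂ * ∑ j, ‖b j‖) ^ 2 * B₁) * (M₂ * (∑ j, ‖b j‖) * BG) * ((M₂ * ∑ j, ‖b j‖) ^ 2 * (θS * B6.c1 dBS δS (1 / 2))) * κT1 * (((ℓ : ℝ) + 1) ^ 4 * ((ℓ : ℝ) + 1) ^ 2 * ((ℓ : ℝ) + 1)) * B6.c1 e21 m (1 / 256) ^ 4 * Real.exp (-((3 / 128 * m) * (3 / 8 * (i.Mh : ℝ) - 2))) + κL * ((M₂ * ∑ j, ‖b j‖) ^ 2 * B₁) * κR * (((ℓ : ℝ)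 + 1) ^ 4 * ((ℓ : ℝ) + 1)) * B6.c1 e21 m (1 / 256) ^ 2 * Real.exp (-((3 / 128 * m) * (3 / 8 * (i.Mh : ℝ) - 1))) + κL * κSb * κR * (((ℓ : ℝ) + 1) ^ 4 * ((ℓ : ℝ) + 1)) * B6.c1 e21 m (1 / 256) ^ 2 * Real.exp (-((3 / 128 * m) * (3 / 8 * (i.Mh : ℝ) - 1))) + κL * Real.exp (-((3 / 128 * m) * (3 / 8 * (i.Mh : ℝ) - 1))) * (((M₂ * ∑ j, ‖b j‖) ^ 2 * B₁) * κR * ((ℓ : ℝ) + 1) * B6.c1 e21 m (1 / 256)) * ((ℓ : ℝ) + 1) ^ 3 * B6.c1 e21 m (1 / 256) + κL * Real.exp (-((3 / 128 * m) * (3 / 8 * (i.Mh : ℝ) - 1))) * κG * ((ℓ : ℝ) + 1) ^ 3 * B6.c1 e21 m (1 / 256)) ≤ ε₃ := by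
    rw [hε₃def]; gcongr
  -- ─── the record ───
  have hrec := hasMajorant_sum_famThree_at_locCfg_of_tails_closed i b cfg par hE hBG hδG.le Oc hBO hδO hEO ιB hι hpar hM₂ hrepr hη hs hB₁ hCinv u hu A Q
    (kGeo i).eta hQ hgA hU hV dBS e12 hθS hδS.le (by norm_num : (1 : ℝ) / 2 ≤ 1) (by norm_num : (0 : ℝ) ≤ 1 / 8)
    (by positivity : (0 : ℝ) ≤ m / (8 * δG)) (by
      have : m / (8 * δG) ≤ 1 / 8 := by rw [div_le_iff₀ (by positivity)]; linarith only [hmG]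
      linarith only [this] : 1 / 8 + m / (8 * δG) ≤ 1)
    (by
      have : m / (4 * δG) * δG = m / 4 := by field_simp
      rw [this]; linarith only [hmS, hm.le] : m / (4 * δG) * δG ≤ (1 - 1 / 2) * δS)
    h261Sc h261_12G hR hεDT
    (by
      have : m / (8 * δG) * δG = 1 / 8 * m := by field_simp
      rw [this] : 1 / 8 * m ≤ m / (8 * δG) * δG)
    hεRT (le_rfl : 1 / 8 * m ≤ 1 / 8 * m)
    e12 hm.le (by linarith only [hmG] : 1 * m ≤ δG) (by norm_num : (0 : ℝ) ≤ 1 / 8) hL0.le hT13 hL0.le hTst (by norm_num : (0 : ℝ) ≤ 1 / 8)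
    (by norm_num : (0 : ℝ) ≤ 1 / 8) (by norm_num : (1 : ℝ) / 4 + 1 / 8 ≤ 3 / 8) (by norm_num : (1 : ℝ) / 8 + 1 / 8 + 1 / 8 ≤ 1) h261_12m
    dBS hθS hδS.le (by norm_num : (1 : ℝ) / 2 ≤ 1) h261Sc hTc (by linarith only [hmS, hm.le] : 3 / 8 * m ≤ (1 - 1 / 2) * δS) hεR3
    (le_of_eq (by ring) : 1 / 8 * m ≤ 1 / 8 * m)
    hX hXc e21 hκL hκPb hκT0 hκT1 hκT2 hκSb hκR hκG
    (by positivity : (0 : ℝ) ≤ ((ℓ : ℝ) + 1) ^ 4) (by positivity : (0 : ℝ) ≤ ((ℓ : ℝ) + 1) ^ 2) (by positivity : (0 : ℝ) ≤ ((ℓ : ℝ) + 1) ^ 3)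
    hL0.le hL0.le
    (by positivity : (0 : ℝ) ≤ 1 / 256 * m) (by positivity : (0 : ℝ) ≤ (1 / 256 + 1 / 256) * m) (by positivity : (0 : ℝ) ≤ 3 / 128 * m)
    (by linarith only [hm.le] : (0 : ℝ) ≤ 1 / 8 * m - 5 * ((1 / 256 + 1 / 256) * m) - 3 / 128 * m)
    (by linarith only [hmX, hm.le] : 1 / 8 * m - (1 / 256 + 1 / 256) * m ≤ δX)
    (by linarith only [hmG, hm.le] : 1 / 8 * m - 2 * ((1 / 256 + 1 / 256) * m) ≤ δG)
    (by
      have : m / (4 * δG) * δG = m / 4 := by field_simp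
      rw [this]; linarith only [hm.le] : 1 / 8 * m - 3 * ((1 / 256 + 1 / 256) * m) - 3 / 128 * m ≤ m / (4 * δG) * δG)
    (by linarith only [hm.le] : 1 / 8 * m - 4 * ((1 / 256 + 1 / 256) * m) - 3 / 128 * m ≤ 1 / 8 * m)
    (by linarith only [hm.le] : 1 / 8 * m - 4 * ((1 / 256 + 1 / 256) * m) - 3 / 128 * m ≤ 1 / 8 * m)
    (by linarith only [hm.le] : 1 / 8 * m - 2 * ((1 / 256 + 1 / 256) * m) - 3 / 128 * m ≤ 1 / 8 * m)
    (by linarith only [hm.le, hmC] : 1 / 8 * m - (1 / 256 + 1 / 256) * m ≤ (1 - 1 / 2) * δC)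
    (by linarith only [hm.le] : 1 / 8 * m - 2 * ((1 / 256 + 1 / 256) * m) - 3 / 128 * m ≤ 1 / 8 * m)
    (by linarith only [hm.le] : 1 / 8 * m - 5 * ((1 / 256 + 1 / 256) * m) - 3 / 128 * m ≤ 1 / 16 * m)
    hST4w hST2w hST3w hSTm1w hST1w h261_21 hLw hRop hTail0 hTail1 hTail2 hSbL hGw hPb
    e11 (le_trans hL1 ((pow_one _).symm.le.trans (hLpow (by norm_num))) : (1 : ℝ) ≤ ((ℓ : ℝ) + 1) ^ 4)
    (by positivity : (0 : ℝ) ≤ 1 / 16 * m) (by norm_num : (0 : ℝ) ≤ 1 / 8) (by norm_num : (0 : ℝ) ≤ 1 / 8) (by positivity : (0 : ℝ) ≤ 1 / 8 * m)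
    (by linarith only [hmG, hm.le] : 1 / 8 * m ≤ δG) (by linarith only [hmX, hm.le] : 1 / 8 * m ≤ δX) (le_rfl : 1 / 8 * m ≤ 1 / 8 * m)
    (by linarith only [hm.le] : 1 / 16 * m + (2 * (1 / 8) + 1 / 8) * (1 / 8 * m) ≤ 1 / 8 * m) h261_11 hT1 hT4
    hε₃w
    (by linarith only [hm.le] : 1 / 16 * m ≤ 1 / 8 * m - 5 * ((1 / 256 + 1 / 256) * m) - 3 / 128 * m)
    e22 (by positivity : (0 : ℝ) ≤ ((ℓ : ℝ) + 1) ^ 2) hρ'.le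
    (by
      have : r' / 2 + ρ' ≤ r' := by linarith only [hρ'r]
      rw [← hr'def]; exact this : r' / 2 + ρ' ≤ 1 / 16 * m / δO)
    h261_22O hSTO
  -- ─── the kernel: collect `E` and rewrite it in `M_h` ───
  refine hasMajorant_mono (g := toB6 (geo9K i) (Rr i) (Hp i)) _ hrec fun a a' => ?_
  have hεT_eq : εT = εT1 * E := by rw [hεTdef, hεRdef, hεT1def]; ring
  have hε₃_eq : ε₃ = ε31 * E := by rw [hε₃def, hε31def]; ring
  have hMhEq : ((toKT i).Mh : ℝ) = (i.Mh : ℝ) := rfl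
  have hEexp : E = Real.exp (3 / 128 * m * 3) * Real.exp (-(3 / 128 * m * (3 / 8) * ((toKT i).Mh : ℝ))) := by
    rw [hEdef, ← Real.exp_add, hMhEq]; congr 1; ring
  have hK : (3 * 5 ^ (d + 1)) * (((M₂ * ∑ j, ‖b j‖) * (M₂ * ∑ j, ‖b j‖) * B₁ * (((ℓ : ℝ) + 1) ^ 4) ^ 4 * B6.c1 e11 (1 / 8 * m) (1 / 8) ^ 2 * (((d : ℝ) + 1) * εT * (2 * ((M₂ * ∑ j, ‖b j‖) * BG) + εT)) + ε₃) * ((M₂ * ∑ j, ‖b j‖) * BO) * ((ℓ : ℝ) + 1) ^ 2 * B6.c1 e22 δO (1 - ρ')) ≤ Θ₃ * Real.exp (-(3 / 128 * m * (3 / 8) * ((toKT i).Mh : ℝ))) := by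
    rw [hεT_eq, hε₃_eq, hΘ₃def, mul_assoc _ (Real.exp (3 / 128 * m * 3)), ← hEexp]
    have hd1 : (0 : ℝ) ≤ (d : ℝ) + 1 := by positivity
    have hεE : εT1 * E ≤ εT1 := by simpa using mul_le_mul_of_nonneg_left hE1 hεT1
    have h1 : εT1 * E * (2 * ((M₂ * ∑ j, ‖b j‖) * BG) + εT1 * E) ≤ εT1 * (2 * ((M₂ * ∑ j, ‖b j‖) * BG) + εT1) * E := by
      calc εT1 * E * (2 * ((M₂ * ∑ j, ‖b j‖) * BG) + εT1 * E) = εT1 * (2 * ((M₂ * ∑ j, ‖b j‖) * BG) + εT1 * E) * E := by ring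
        _ ≤ εT1 * (2 * ((M₂ * ∑ j, ‖b j‖) * BG) + εT1) * E := mul_le_mul_of_nonneg_right (mul_le_mul_of_nonneg_left (by linarith only [hεE]) hεT1) hE0
    have h3 : (M₂ * ∑ j, ‖b j‖) * (M₂ * ∑ j, ‖b j‖) * B₁ * (((ℓ : ℝ) + 1) ^ 4) ^ 4 * B6.c1 e11 (1 / 8 * m) (1 / 8) ^ 2 * (((d : ℝ) + 1) * (εT1 * E) * (2 * ((M₂ * ∑ j, ‖b j‖) * BG) + εT1 * E)) ≤
        (M₂ * ∑ j, ‖b j‖) * (M₂ * ∑ j, ‖b j‖) * B₁ * (((ℓ : ℝ) + 1) ^ 4) ^ 4 * B6.c1 e11 (1 / 8 * m) (1 / 8) ^ 2 * (((d : ℝ) + 1) * (εT1 * (2 * ((M₂ * ∑ j, ‖b j‖) * BG) + εT1) * E)) := by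
      refine mul_le_mul_of_nonneg_left ?_ (by positivity)
      calc ((d : ℝ) + 1) * (εT1 * E) * (2 * ((M₂ * ∑ j, ‖b j‖) * BG) + εT1 * E) = ((d : ℝ) + 1) * (εT1 * E * (2 * ((M₂ * ∑ j, ‖b j‖) * BG) + εT1 * E)) := by ring
        _ ≤ ((d : ℝ) + 1) * (εT1 * (2 * ((M₂ * ∑ j, ‖b j‖) * BG) + εT1) * E) := mul_le_mul_of_nonneg_left h1 hd1
    have h2 : (M₂ * ∑ j, ‖b j‖) * (M₂ * ∑ j, ‖b j‖) * B₁ * (((ℓ : ℝ) + 1) ^ 4) ^ 4 * B6.c1 e11 (1 / 8 * m) (1 / 8) ^ 2 * (((d : ℝ) + 1) * (εT1 * E) * (2 * ((M₂ * ∑ j, ‖b j‖) * BG) + εT1 * E)) + ε31 * E ≤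
        ((M₂ * ∑ j, ‖b j‖) * (M₂ * ∑ j, ‖b j‖) * B₁ * (((ℓ : ℝ) + 1) ^ 4) ^ 4 * B6.c1 e11 (1 / 8 * m) (1 / 8) ^ 2 * (((d : ℝ) + 1) * εT1 * (2 * ((M₂ * ∑ j, ‖b j‖) * BG) + εT1)) + ε31) * E := by
      calc (M₂ * ∑ j, ‖b j‖) * (M₂ * ∑ j, ‖b j‖) * B₁ * (((ℓ : ℝ) + 1) ^ 4) ^ 4 * B6.c1 e11 (1 / 8 * m) (1 / 8) ^ 2 * (((d : ℝ) + 1) * (εT1 * E) * (2 * ((M₂ * ∑ j, ‖b j‖) * BG) + εT1 * E)) + ε31 * E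
          ≤ (M₂ * ∑ j, ‖b j‖) * (M₂ * ∑ j, ‖b j‖) * B₁ * (((ℓ : ℝ) + 1) ^ 4) ^ 4 * B6.c1 e11 (1 / 8 * m) (1 / 8) ^ 2 * (((d : ℝ) + 1) * (εT1 * (2 * ((M₂ * ∑ j, ‖b j‖) * BG) + εT1) * E)) + ε31 * E :=
            add_le_add h3 le_rfl
        _ = ((M₂ * ∑ j, ‖b j‖) * (M₂ * ∑ j, ‖b j‖) * B₁ * (((ℓ : ℝ) + 1) ^ 4) ^ 4 * B6.c1 e11 (1 / 8 * m) (1 / 8) ^ 2 * (((d : ℝ) + 1) * εT1 * (2 * ((M₂ * ∑ j, ‖b j‖) * BG) + εT1)) + ε31) * E := by ring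
    calc (3 * 5 ^ (d + 1)) * (((M₂ * ∑ j, ‖b j‖) * (M₂ * ∑ j, ‖b j‖) * B₁ * (((ℓ : ℝ) + 1) ^ 4) ^ 4 * B6.c1 e11 (1 / 8 * m) (1 / 8) ^ 2 * (((d : ℝ) + 1) * (εT1 * E) * (2 * ((M₂ * ∑ j, ‖b j‖) * BG) + (εT1 * E))) + (ε31 * E)) * ((M₂ * ∑ j, ‖b j‖) * BO) * ((ℓ : ℝ) + 1) ^ 2 * B6.c1 e22 δO (1 - ρ'))
        ≤ (3 * 5 ^ (d + 1)) * ((((M₂ * ∑ j, ‖b j‖) * (M₂ * ∑ j, ‖b j‖) * B₁ * (((ℓ : ℝ) + 1) ^ 4) ^ 4 * B6.c1 e11 (1 / 8 * m) (1 / 8) ^ 2 * (((d : ℝ) + 1) * εT1 * (2 * ((M₂ * ∑ j, ‖b j‖) * BG) + εT1)) + ε31) * E) *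
          ((M₂ * ∑ j, ‖b j‖) * BO) * ((ℓ : ℝ) + 1) ^ 2 * B6.c1 e22 δO (1 - ρ')) :=
          mul_le_mul_of_nonneg_left (mul_le_mul_of_nonneg_right (mul_le_mul_of_nonneg_right (mul_le_mul_of_nonneg_right h2 (by positivity))
            (by positivity)) hc22O) (by positivity)
      _ = (3 * 5 ^ (d + 1)) * (((M₂ * ∑ j, ‖b j‖) * (M₂ * ∑ j, ‖b j‖) * B₁ * (((ℓ : ℝ) + 1) ^ 4) ^ 4 * B6.c1 e11 (1 / 8 * m) (1 / 8) ^ 2 * (((d : ℝ) + 1) * εT1 * (2 * ((M₂ * ∑ j, ‖b j‖) * BG) + εT1)) + ε31) * ((M₂ * ∑ j, ‖b j‖) * BO) * ((ℓ : ℝ) + 1) ^ 2 * B6.c1 e22 δO (1 - ρ')) * E := by ring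
  rw [← mul_assoc]
  exact mul_le_mul_of_nonneg_right hK (Real.exp_nonneg _)

end Literature.MathematicalPhysics.QuantumFieldTheory.Balaban1983to89.B9Eq3105FamThreeAtMember

end
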